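import Literature.Analysis.FluidPDE.LocalLeraySlabGoodSlices
import HarnessLib

/-!
# Local Leray solutions on a slab: the pairing identity for `H¹` test fields `φ w`

Analysis/FluidPDE theorem file (no new definitions), third file of the weak–strong ingredient
of Lemarié-Rieusset 2016, Thm. 14.7 (the balance of `u₁·u₂`, file p. 515: each solution's
equation is tested against (a cut-off of) the other solution, an `H¹_loc` field). The accepted
`IsLocalLeraySolutionOn.ae_pairing_eq_datum_add_weak` (`LocalLeraySlabGoodSlices.lean`) is the
pairing identity from the initial time for smooth compactly supported test fields, written in
the weak form `∫⟪v(t),φ⟫ = ∫⟪v₀,φ⟫ + ∫₀ᵗ(-∫⟪(∇v)v,φ⟫ + ∫π div φ - ν∫∇v:∇φ)` all of whose terms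
make sense for `φ ∈ H¹ ∩ L⁶` with compact support. This file performs the **density step**:

* `IsLocalLeraySolutionOn.ae_pairing_smul_eq_datum_add` — for a local Leray solution `(v, π)`
  on `(0,T) × ℝ³` with measurable datum, a weak spatial gradient `G`, a ball `B`, a field
  `w ∈ L⁶(B)` with weak derivative `Gw ∈ L²(B)` on `B` and `tr Gw = 0` a.e. (a "good slice" of
  another local Leray solution), and a scalar cut-off `ψ ∈ C_c^∞(B)`: for a.e. `t ∈ (0,T)`,
  `∫ ⟪v(t), ψ w⟫ = ∫ ⟪v₀, ψ w⟫ + ∫_{(0,t]} ( -∫ ⟪G v, ψ w⟫ + ∫ π (Dψ w)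
     - ν ∫ ∑ᵢ ⟪G eᵢ, (∂ᵢψ) w + ψ Gw eᵢ⟫ )`.

Proof: mollify the zero extension `𝟙_B w` into smooth `wₖ` (`wₖ → 𝟙_B w` in `L²` and `L⁶`,
`Dwₖ = ρₖ ⋆ 𝟙_B Gw → Gw` in `L²` on `supp ψ`, `tr Dwₖ = 0` on `supp ψ` for large `k` —
`MollificationLocal`, `NSWeakProductRule`), apply the smooth identity to `ψ wₖ`, and pass to the
limit: the bulk terms converge in `L¹(0,T)` by Hölder on the finite cylinder `(0,T) × supp ψ`
(`|G||v||ψ(wₖ-w)| ≤ ‖G‖₂‖v‖₃‖wₖ-w‖₆`, `|π||Dψ||wₖ-w| ≤ ‖π‖_{3/2}‖wₖ-w‖₃`,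
`|G|(|Dψ||wₖ-w| + |ψ||Dwₖ-Gw|) ≤ ‖G‖₂(‖wₖ-w‖₂ + ‖Dwₖ-Gw‖₂)`), the boundary terms at the good time
`t` and at the datum by Cauchy–Schwarz.

## Mathlib / tree search

Tree: `IsLocalLeraySolutionOn.ae_pairing_eq_datum_add_weak` and the good-slice lemmas
(`LocalLeraySlabGoodSlices`); `HasWeakFDerivOn.hasFDerivAt_normed_convolution_indicator`
(`MollificationLocal`); `traceCoord_fderiv_mollified_eq_zero` (`NSWeakProductRule`);
`tendsto_eLpNorm_normed_convolution_sub_self`, `memLp_normed_convolution`, `exists_contDiffBump_seq`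
(`Mollification`, `MollificationLp`); `divergence_smul_apply` (`WholeSpaceIBP`);
`IsLocalLeraySolutionOn.lintegral_cube_box_lt_top`, `.pressure`, `integral_norm_mul_norm_le_toReal`.
Mathlib: `ENNReal.lintegral_mul_le_Lp_mul_Lq`, `HasCompactSupport.exists_cthickening_subset_open`.

## References

* P. G. Lemarié-Rieusset, *The Navier–Stokes Problem in the 21st Century*, CRC Press 2016,
  doi:10.1201/b19556: Thm. 14.7, proof, p. 515; Prop. 14.1, p. 498. [LemarieRieusset2016]
* L. C. Evans, *Partial Differential Equations* (2010), §5.3.1 Thm. 1 (interior mollification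
  of Sobolev functions). [Evans2010]
-/

noncomputable section

open MeasureTheory TopologicalSpace Set Function Filter Metric
open _root_.Topology
open scoped ENNReal NNReal RealInnerProductSpace Convolution

namespace Literature.Analysis.FluidPDE

open FunctionSpaces SerrinBoundedHolder BradshawTsai2019

/-! ## Hölder-type bounds in `ℝ≥0∞` -/

section Holder

variable {α : Type*} [MeasurableSpace α] {μ : Measure α}

/-- Hölder with exponents `(3/2, 3)`: `∫⁻ f g ≤ (∫⁻ f^{3/2})^{2/3} (∫⁻ g³)^{1/3}`. [folklore] -/
theorem lintegral_mul_le_L32_L3 {f g : α → ℝ≥0∞} (hf : AEMeasurable f μ) (hg : AEMeasurable g μ) :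
    ∫⁻ x, f x * g x ∂μ ≤
      (∫⁻ x, f x ^ (3 / 2 : ℝ) ∂μ) ^ (2 / 3 : ℝ) * (∫⁻ x, g x ^ 3 ∂μ) ^ (1 / 3 : ℝ) := by
  have hpq : (3 / 2 : ℝ).HolderConjugate 3 := Real.holderConjugate_iff.2 ⟨by norm_num, by norm_num⟩
  have h := ENNReal.lintegral_mul_le_Lp_mul_Lq μ hpq hf hg
  norm_num at h
  exact h

/-- Hölder with exponents `(2, 2)`: `∫⁻ f g ≤ (∫⁻ f²)^{1/2} (∫⁻ g²)^{1/2}`. [folklore] -/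
theorem lintegral_mul_le_L2_L2 {f g : α → ℝ≥0∞} (hf : AEMeasurable f μ) (hg : AEMeasurable g μ) :
    ∫⁻ x, f x * g x ∂μ ≤
      (∫⁻ x, f x ^ 2 ∂μ) ^ (1 / 2 : ℝ) * (∫⁻ x, g x ^ 2 ∂μ) ^ (1 / 2 : ℝ) := by
  have h := ENNReal.lintegral_mul_le_Lp_mul_Lq μ Real.HolderConjugate.two_two hf hg
  norm_num at h
  exact h

/-- Hölder with exponents `(2, 3, 6)`: `∫⁻ f g h ≤ (∫⁻ f²)^{1/2} (∫⁻ g³)^{1/3} (∫⁻ h⁶)^{1/6}`.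
[folklore] -/
theorem lintegral_mul_mul_le_L2_L3_L6 {f g h : α → ℝ≥0∞} (hf : AEMeasurable f μ)
    (hg : AEMeasurable g μ) (hh : AEMeasurable h μ) :
    ∫⁻ x, f x * g x * h x ∂μ ≤
      (∫⁻ x, f x ^ 2 ∂μ) ^ (1 / 2 : ℝ) * (∫⁻ x, g x ^ 3 ∂μ) ^ (1 / 3 : ℝ) *
        (∫⁻ x, h x ^ 6 ∂μ) ^ (1 / 6 : ℝ) := by
  -- `∫ f (g h) ≤ ‖f‖₂ ‖g h‖₂`
  have hgh : AEMeasurable (fun x => g x * h x) μ := hg.mul hh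
  have h1 : ∫⁻ x, f x * g x * h x ∂μ ≤
      (∫⁻ x, f x ^ 2 ∂μ) ^ (1 / 2 : ℝ) * (∫⁻ x, (g x * h x) ^ 2 ∂μ) ^ (1 / 2 : ℝ) := by
    have := lintegral_mul_le_L2_L2 (μ := μ) hf hgh
    simpa only [mul_assoc] using this
  -- `‖g h‖₂² = ∫ g² h² ≤ (∫ g³)^{2/3} (∫ h⁶)^{1/3}`
  have h2 : ∫⁻ x, (g x * h x) ^ 2 ∂μ ≤
      (∫⁻ x, g x ^ 3 ∂μ) ^ (2 / 3 : ℝ) * (∫⁻ x, h x ^ 6 ∂μ) ^ (1 / 3 : ℝ) := by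
    have h3 := lintegral_mul_le_L32_L3 (μ := μ) (hg.pow_const 2) (hh.pow_const 2)
    have e2 : ∀ x, (g x ^ 2) ^ (3 / 2 : ℝ) = g x ^ 3 := fun x => by
      rw [← ENNReal.rpow_natCast (g x) 2, ← ENNReal.rpow_mul, ← ENNReal.rpow_natCast (g x) 3]
      norm_num
    have e3 : ∀ x, (h x ^ 2) ^ 3 = h x ^ 6 := fun x => by rw [← pow_mul]
    simp only [e2, e3] at h3
    calc ∫⁻ x, (g x * h x) ^ 2 ∂μ = ∫⁻ x, g x ^ 2 * h x ^ 2 ∂μ :=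
          lintegral_congr fun x => mul_pow _ _ _
      _ ≤ _ := h3
  calc ∫⁻ x, f x * g x * h x ∂μ
      ≤ (∫⁻ x, f x ^ 2 ∂μ) ^ (1 / 2 : ℝ) * (∫⁻ x, (g x * h x) ^ 2 ∂μ) ^ (1 / 2 : ℝ) := h1
    _ ≤ (∫⁻ x, f x ^ 2 ∂μ) ^ (1 / 2 : ℝ) *
          ((∫⁻ x, g x ^ 3 ∂μ) ^ (2 / 3 : ℝ) * (∫⁻ x, h x ^ 6 ∂μ) ^ (1 / 3 : ℝ)) ^ (1 / 2 : ℝ) := by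
        gcongr
    _ = _ := by
        rw [ENNReal.mul_rpow_of_nonneg _ _ (by norm_num : (0 : ℝ) ≤ 1 / 2), ← ENNReal.rpow_mul,
          ← ENNReal.rpow_mul]
        norm_num
        ring

end Holder


/-! ## Small tools -/

section Tools

/-- The divergence is the coordinate trace of the derivative (`div u = ∑ⱼ ∂ⱼuⱼ`). [folklore] -/
theorem divergence_eq_traceCoord (u : EuclideanSpace ℝ (Fin 3) → EuclideanSpace ℝ (Fin 3))
    (x : EuclideanSpace ℝ (Fin 3)) :
    VectorCalculus.divergence u x = traceCoord (fderiv ℝ u x) := by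
  rw [divergence_eq_sum_inner_fderiv (EuclideanSpace.basisFun (Fin 3) ℝ) u x, traceCoord_apply]
  refine Finset.sum_congr rfl fun i _ => ?_
  rw [EuclideanSpace.basisFun_apply, EuclideanSpace.inner_single_left]
  simp

/-- The mollification of a zero extension, evaluated: `(ρ ⋆ 𝟙_S g)(x) = ∫_S ρ(x - y) • g(y) dy`.
[folklore] -/
theorem normed_convolution_indicator_apply {F : Type*} [NormedAddCommGroup F] [NormedSpace ℝ F]
    (ρ : ContDiffBump (0 : EuclideanSpace ℝ (Fin 3))) {S : Set (EuclideanSpace ℝ (Fin 3))}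
    (hS : MeasurableSet S) (g : EuclideanSpace ℝ (Fin 3) → F) (x : EuclideanSpace ℝ (Fin 3)) :
    (ρ.normed volume ⋆[ContinuousLinearMap.lsmul ℝ ℝ, volume] S.indicator g) x =
      ∫ y in S, ρ.normed volume (x - y) • g y := by
  rw [convolution_def]
  simp only [ContinuousLinearMap.lsmul_apply]
  rw [← integral_sub_left_eq_self (fun t => ρ.normed volume t • S.indicator g (x - t)) volume x,
    ← integral_indicator hS]
  congr 1 with y
  simp only [sub_sub_cancel, Set.indicator_smul_apply]

/-- `∫⁻_{(0,T)×K} f(x) = |(0,T)| ∫⁻_K f` for a function of the space variable only. [folklore] -/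
theorem lintegral_cylinder_comp_snd {T : ℝ} {K : Set (EuclideanSpace ℝ (Fin 3))}
    (f : EuclideanSpace ℝ (Fin 3) → ℝ≥0∞) (hf : AEMeasurable f (volume.restrict K)) :
    ∫⁻ z in Ioo (0 : ℝ) T ×ˢ K, f z.2 = volume (Ioo (0 : ℝ) T) * ∫⁻ x in K, f x := by
  rw [Measure.volume_eq_prod, ← Measure.prod_restrict]
  have := lintegral_prod_mul (μ := (volume : Measure ℝ).restrict (Ioo 0 T))
    (ν := volume.restrict K) (f := fun _ => (1 : ℝ≥0∞)) (g := f) aemeasurable_const hf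
  simp only [one_mul, lintegral_const, Measure.restrict_apply_univ] at this
  exact this

end Tools


/-- `∫⁻_K ‖f‖ₑⁿ ≤ ‖f‖_{Lⁿ}ⁿ` for a natural exponent `n ≠ 0`. [folklore] -/
theorem setLIntegral_pow_enorm_le_eLpNorm_pow {X F : Type*} [MeasurableSpace X] {μ : Measure X}
    [NormedAddCommGroup F] (f : X → F) (K : Set X) {n : ℕ} (hn : n ≠ 0) :
    ∫⁻ x in K, ‖f x‖ₑ ^ n ∂μ ≤ eLpNorm f n μ ^ n := by
  have hn0 : (n : ℝ≥0∞) ≠ 0 := by exact_mod_cast hn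
  have key : eLpNorm f n μ ^ n = ∫⁻ x, ‖f x‖ₑ ^ n ∂μ := by
    rw [eLpNorm_eq_lintegral_rpow_enorm_toReal hn0 (ENNReal.natCast_ne_top n), ENNReal.toReal_natCast,
      ← ENNReal.rpow_natCast, ← ENNReal.rpow_mul, one_div, inv_mul_cancel₀ (by exact_mod_cast hn),
      ENNReal.rpow_one]
    exact lintegral_congr fun x => ENNReal.rpow_natCast _ _
  rw [key]
  exact lintegral_mono' Measure.restrict_le_self le_rfl

/-! ## The density step -/

namespace IsLocalLeraySolutionOn

variable {T ν : ℝ} {v₀ : EuclideanSpace ℝ (Fin 3) → EuclideanSpace ℝ (Fin 3)}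
  {v : ℝ → EuclideanSpace ℝ (Fin 3) → EuclideanSpace ℝ (Fin 3)}
  {π : ℝ → EuclideanSpace ℝ (Fin 3) → ℝ}

set_option maxHeartbeats 1000000 in
/-- **The pairing identity from the initial time for the `H¹` test fields `ψ w`** (the density
step of the weak–strong argument, Lemarié-Rieusset 2016, proof of Thm. 14.7, p. 515: each
solution's equation tested with a cut-off of a slice of the other solution). Let `(v, π)` be a
local Leray solution on `(0,T) × ℝ³`, `T > 0`, with measurable datum `v₀` and a weak spatial
gradient `G` on the slab; let `B = B(0,R)`, `R > 0`, and let `w ∈ L⁶(B)` have a weak derivative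
`Gw ∈ L²(B)` on `B` with `tr Gw = 0` a.e. on `B`; let `ψ ∈ C_c^∞(B)` be a scalar cut-off. Then
for a.e. `t ∈ (0,T)`, with `(eᵢ)` the standard orthonormal frame,
`∫ ⟪v(t), ψ w⟫ = ∫ ⟪v₀, ψ w⟫ + ∫_{(0,t]} ( (-∫ ⟪G(s) v(s), ψ w⟫ + ∫ π(s) Dψ(w))
  - ν ∫ ∑ᵢ ⟪G(s) eᵢ, (∂ᵢψ) w + ψ Gw eᵢ⟫ ) ds`.
Proof: module docstring. [cite: LemarieRieusset2016, Thm. 14.7 proof (file p. 515); Evans2010 §5.3.1 Thm. 1] -/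
theorem ae_pairing_smul_eq_datum_add (h : IsLocalLeraySolutionOn T ν v₀ v π) (hT : 0 < T)
    (hm₀ : AEStronglyMeasurable v₀ volume)
    {G : ℝ → EuclideanSpace ℝ (Fin 3) → EuclideanSpace ℝ (Fin 3) →L[ℝ] EuclideanSpace ℝ (Fin 3)}
    (hG : HasWeakSpatialGradientOn (slab (EuclideanSpace ℝ (Fin 3)) (Ioo 0 T) isOpen_Ioo) v G)
    {R : ℝ} (hR : 0 < R) {w : EuclideanSpace ℝ (Fin 3) → EuclideanSpace ℝ (Fin 3)}
    {Gw : EuclideanSpace ℝ (Fin 3) → EuclideanSpace ℝ (Fin 3) →L[ℝ] EuclideanSpace ℝ (Fin 3)}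
    (hw : HasWeakFDerivOn (⟨ball (0 : EuclideanSpace ℝ (Fin 3)) R, isOpen_ball⟩ :
      Opens (EuclideanSpace ℝ (Fin 3))) volume w Gw)
    (hw6 : ∫⁻ x in ball (0 : EuclideanSpace ℝ (Fin 3)) R, ‖w x‖ₑ ^ 6 < ∞)
    (hGw2 : ∫⁻ x in ball (0 : EuclideanSpace ℝ (Fin 3)) R, ‖Gw x‖ₑ ^ 2 < ∞)
    (htr : ∀ᵐ x ∂(volume.restrict (ball (0 : EuclideanSpace ℝ (Fin 3)) R)),
      ∑ j, Gw x (EuclideanSpace.single j (1 : ℝ)) j = 0)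
    {ψ : EuclideanSpace ℝ (Fin 3) → ℝ}
    (hψ : IsTestFunctionOn (⟨ball (0 : EuclideanSpace ℝ (Fin 3)) R, isOpen_ball⟩ :
      Opens (EuclideanSpace ℝ (Fin 3))) ψ) :
    ∀ᵐ t ∂((volume : Measure ℝ).restrict (Ioo 0 T)),
      ∫ x, ⟪v t x, ψ x • w x⟫ = (∫ x, ⟪v₀ x, ψ x • w x⟫) +
        ∫ s in Ioc 0 t, (((-∫ x, ⟪G s x (v s x), ψ x • w x⟫) + ∫ x, π s x * fderiv ℝ ψ x (w x)) -
          ν * ∫ x, ∑ i, ⟪G s x (stdOrthonormalBasis ℝ (EuclideanSpace ℝ (Fin 3)) i),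
            fderiv ℝ ψ x (stdOrthonormalBasis ℝ (EuclideanSpace ℝ (Fin 3)) i) • w x +
              ψ x • Gw x (stdOrthonormalBasis ℝ (EuclideanSpace ℝ (Fin 3)) i)⟫) := by
  set e := stdOrthonormalBasis ℝ (EuclideanSpace ℝ (Fin 3)) with he
  -- ### the ball, the compact shadow, the cut-off
  set B : Set (EuclideanSpace ℝ (Fin 3)) := ball 0 R with hB
  have hBm : MeasurableSet B := measurableSet_ball
  set K : Set (EuclideanSpace ℝ (Fin 3)) := closedBall 0 R with hKdef
  have hK : IsCompact K := isCompact_closedBall _ _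
  have hBK : B ⊆ K := ball_subset_closedBall
  have hψK : tsupport ψ ⊆ B := hψ.tsupport_subset
  have hψ0 : ∀ x, x ∉ tsupport ψ → ψ x = 0 := fun x hx => image_eq_zero_of_notMem_tsupport hx
  have hDψ0 : ∀ x, x ∉ tsupport ψ → fderiv ℝ ψ x = 0 := fun x hx => fderiv_of_notMem_tsupport ℝ hx
  have hψd : Differentiable ℝ ψ := hψ.contDiff.differentiable (by simp)
  have hψc : Continuous ψ := hψ.contDiff.continuous
  have hDψc : Continuous (fderiv ℝ ψ) := hψ.contDiff.continuous_fderiv (by simp)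
  obtain ⟨Cψ, hCψ⟩ := hψc.bounded_above_of_compact_support hψ.hasCompactSupport
  obtain ⟨CD, hCD⟩ := hDψc.bounded_above_of_compact_support (hψ.hasCompactSupport.fderiv ℝ)
  have hCψ0 : 0 ≤ Cψ := (norm_nonneg _).trans (hCψ 0)
  have hCD0 : 0 ≤ CD := (norm_nonneg _).trans (hCD 0)
  -- ### `w`, `Gw` on `B`: measurability, `L⁶`, `L³`, `L²`, `L¹`
  haveI hfinB : IsFiniteMeasure (volume.restrict B) :=
    ⟨by rw [Measure.restrict_apply_univ]; exact measure_ball_lt_top⟩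
  have hwm : AEStronglyMeasurable w (volume.restrict B) := hw.locallyIntegrableOn.aestronglyMeasurable
  have hGwm : AEStronglyMeasurable Gw (volume.restrict B) := hw.locallyIntegrableOn_deriv.aestronglyMeasurable
  have hwL6 : MemLp w 6 (volume.restrict B) := by
    refine ⟨hwm, ?_⟩
    rw [eLpNorm_lt_top_iff_lintegral_rpow_enorm_lt_top (by norm_num) ENNReal.ofNat_ne_top]
    simp only [ENNReal.toReal_ofNat, ENNReal.rpow_ofNat]
    exact hw6
  have hwL3 : MemLp w 3 (volume.restrict B) := hwL6.mono_exponent (by norm_num)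
  have hwL2 : MemLp w 2 (volume.restrict B) := hwL6.mono_exponent (by norm_num)
  have hGwL2 : MemLp Gw 2 (volume.restrict B) := by
    refine ⟨hGwm, ?_⟩
    rw [eLpNorm_lt_top_iff_lintegral_rpow_enorm_lt_top two_ne_zero ENNReal.ofNat_ne_top]
    simp only [ENNReal.toReal_ofNat, ENNReal.rpow_ofNat]
    exact hGw2
  have hwI : IntegrableOn w B volume := hwL2.integrable one_le_two
  have hGwI : IntegrableOn Gw B volume := hGwL2.integrable one_le_two
  -- zero extensions: of `w`, and of the columns `Gw(·) eᵢ` of the gradient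
  set wt : EuclideanSpace ℝ (Fin 3) → EuclideanSpace ℝ (Fin 3) := B.indicator w with hwt
  have hwt6 : MemLp wt 6 volume := by rw [hwt]; exact (memLp_indicator_iff_restrict hBm).2 hwL6
  have hwt3 : MemLp wt 3 volume := by rw [hwt]; exact (memLp_indicator_iff_restrict hBm).2 hwL3
  have hwt2 : MemLp wt 2 volume := by rw [hwt]; exact (memLp_indicator_iff_restrict hBm).2 hwL2
  have hwtI : Integrable wt volume := by rw [hwt]; exact hwI.integrable_indicator hBm
  have hwtli : LocallyIntegrable wt volume := hwtI.locallyIntegrable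
  have hGwiL2 : ∀ i, MemLp (fun y => Gw y (e i)) 2 (volume.restrict B) := fun i =>
    MemLp.of_le hGwL2 (hGwm.apply_continuousLinearMap (e i)) (Eventually.of_forall fun y =>
      (ContinuousLinearMap.le_opNorm _ _).trans (by rw [(e.orthonormal.1 i), mul_one]))
  set Gti : Fin (Module.finrank ℝ (EuclideanSpace ℝ (Fin 3))) → EuclideanSpace ℝ (Fin 3) → EuclideanSpace ℝ (Fin 3) :=
    fun i => B.indicator fun y => Gw y (e i) with hGti
  have hGti2 : ∀ i, MemLp (Gti i) 2 volume := fun i => by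
    simp only [hGti]; exact (memLp_indicator_iff_restrict hBm).2 (hGwiL2 i)
  have hGtiI : ∀ i, Integrable (Gti i) volume := fun i => by
    simp only [hGti]
    exact IntegrableOn.integrable_indicator ((hGwiL2 i).integrable one_le_two) hBm
  -- `ψ w = ψ wt` etc.: the cut-off kills the difference off `B`
  have hψw : ∀ x, ψ x • w x = ψ x • wt x := fun x => by
    by_cases hx : x ∈ B
    · simp only [hwt, indicator_of_mem hx]
    · rw [hψ0 x (fun h' => hx (hψK h')), zero_smul, zero_smul]
  have hDψw : ∀ x (a : EuclideanSpace ℝ (Fin 3)), fderiv ℝ ψ x a • w x = fderiv ℝ ψ x a • wt x := fun x a => by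
    by_cases hx : x ∈ B
    · simp only [hwt, indicator_of_mem hx]
    · rw [hDψ0 x (fun h' => hx (hψK h'))]
      simp
  have hDψw' : ∀ x, fderiv ℝ ψ x (w x) = fderiv ℝ ψ x (wt x) := fun x => by
    by_cases hx : x ∈ B
    · simp only [hwt, indicator_of_mem hx]
    · rw [hDψ0 x (fun h' => hx (hψK h'))]
      simp
  have hψG : ∀ x i, ψ x • Gw x (e i) = ψ x • Gti i x := fun x i => by
    by_cases hx : x ∈ B
    · simp only [hGti, indicator_of_mem hx]
    · rw [hψ0 x (fun h' => hx (hψK h')), zero_smul, zero_smul]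
  -- ### mollifications
  obtain ⟨bump, hbr, hratio⟩ := exists_contDiffBump_seq (E := EuclideanSpace ℝ (Fin 3))
  set wk : ℕ → EuclideanSpace ℝ (Fin 3) → EuclideanSpace ℝ (Fin 3) := fun k =>
    (bump k).normed volume ⋆[ContinuousLinearMap.lsmul ℝ ℝ, volume] wt with hwk
  set Dki : ℕ → Fin (Module.finrank ℝ (EuclideanSpace ℝ (Fin 3))) → EuclideanSpace ℝ (Fin 3) →
      EuclideanSpace ℝ (Fin 3) := fun k i =>
    (bump k).normed volume ⋆[ContinuousLinearMap.lsmul ℝ ℝ, volume] Gti i with hDki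
  have hwk_smooth : ∀ k, ContDiff ℝ (⊤ : ℕ∞) (wk k) := fun k =>
    (bump k).hasCompactSupport_normed.contDiff_convolution_left _ (bump k).contDiff_normed hwtli
  have hwkd : ∀ k x, DifferentiableAt ℝ (wk k) x := fun k x =>
    ((hwk_smooth k).differentiable (by simp)).differentiableAt
  have hDki_cont : ∀ k i, Continuous (Dki k i) := fun k i =>
    ((bump k).hasCompactSupport_normed.contDiff_convolution_left _ ((bump k).contDiff_normed (n := 0))
      (hGtiI i).locallyIntegrable).continuous
  have hwk6 : ∀ k, MemLp (wk k) 6 volume := fun k => memLp_normed_convolution (bump k) hwt6 (by norm_num)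
  have hwk3 : ∀ k, MemLp (wk k) 3 volume := fun k => memLp_normed_convolution (bump k) hwt3 (by norm_num)
  have hwk2 : ∀ k, MemLp (wk k) 2 volume := fun k => memLp_normed_convolution (bump k) hwt2 one_le_two
  have hDki2 : ∀ k i, MemLp (Dki k i) 2 volume := fun k i => memLp_normed_convolution (bump k) (hGti2 i) one_le_two
  -- `L⁶`, `L³`, `L²` convergences
  have hL6 : Tendsto (fun k => eLpNorm (wk k - wt) 6 volume) atTop (𝓝 0) :=
    tendsto_eLpNorm_normed_convolution_sub_self hbr (by norm_num) ENNReal.ofNat_ne_top hwt6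
  have hL3 : Tendsto (fun k => eLpNorm (wk k - wt) 3 volume) atTop (𝓝 0) :=
    tendsto_eLpNorm_normed_convolution_sub_self hbr (by norm_num) ENNReal.ofNat_ne_top hwt3
  have hL2 : Tendsto (fun k => eLpNorm (wk k - wt) 2 volume) atTop (𝓝 0) :=
    tendsto_eLpNorm_normed_convolution_sub_self hbr one_le_two ENNReal.ofNat_ne_top hwt2
  have hDL2 : ∀ i, Tendsto (fun k => eLpNorm (Dki k i - Gti i) 2 volume) atTop (𝓝 0) := fun i =>
    tendsto_eLpNorm_normed_convolution_sub_self hbr one_le_two ENNReal.ofNat_ne_top (hGti2 i)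
  -- ### room between `supp ψ` and `∂B`; the large `k`
  obtain ⟨δ, hδ, hδB⟩ := hψ.hasCompactSupport.exists_cthickening_subset_open isOpen_ball hψK
  have hN : ∀ᶠ k in atTop, (bump k).rOut < δ := hbr (gt_mem_nhds hδ)
  have hsubB : ∀ k, (bump k).rOut < δ → ∀ x ∈ tsupport ψ, closedBall x (bump k).rOut ⊆ B :=
    fun k hk x hx => (closedBall_subset_cthickening hx _).trans ((cthickening_mono hk.le _).trans hδB)
  -- on `supp ψ`: the columns of `D wk` are the `Dki`, and `tr D wk = 0`
  have hfd : ∀ k, (bump k).rOut < δ → ∀ x ∈ tsupport ψ, ∀ i, fderiv ℝ (wk k) x (e i) = Dki k i x := by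
    intro k hk x hx i
    have hD := hw.hasFDerivAt_normed_convolution_indicator hwI hGwI (bump k) (hsubB k hk x hx)
    have e1 : fderiv ℝ (wk k) x = ∫ y in B, (bump k).normed volume (x - y) • Gw y := hD.fderiv
    -- integrability of the operator-valued integrand on `B`
    have hρ := isTestFunctionOn_normed_comp_sub (U := (⟨ball (0 : EuclideanSpace ℝ (Fin 3)) R, isOpen_ball⟩ :
      Opens (EuclideanSpace ℝ (Fin 3)))) (μ := volume) (bump k) (hsubB k hk x hx)
    obtain ⟨Cρ, hCρ⟩ := hρ.contDiff.continuous.bounded_above_of_compact_support hρ.hasCompactSupport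
    have hint : Integrable (fun y => (bump k).normed volume (x - y) • Gw y) (volume.restrict B) :=
      hGwI.bdd_smul Cρ hρ.contDiff.continuous.aestronglyMeasurable (ae_of_all _ hCρ)
    rw [e1, show (∫ y in B, (bump k).normed volume (x - y) • Gw y) =
        ∫ y, (bump k).normed volume (x - y) • Gw y ∂(volume.restrict B) from rfl,
      ContinuousLinearMap.integral_apply hint (e i)]
    simp only [_root_.FunLike.coe_smul, Pi.smul_apply]
    simp only [hDki, hGti]
    exact (normed_convolution_indicator_apply (bump k) hBm (fun y => Gw y (e i)) x).symm
  have htr0 : ∀ k, (bump k).rOut < δ → ∀ x ∈ tsupport ψ, traceCoord (fderiv ℝ (wk k) x) = 0 :=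
    fun k hk x hx => traceCoord_fderiv_mollified_eq_zero hw hwI hGwI htr (bump k) (hsubB k hk x hx)
  -- pointwise rewriting of the divergence and of the partial derivatives of `ψ wk`
  have hdivk : ∀ k, (bump k).rOut < δ → ∀ x,
      VectorCalculus.divergence (fun y => ψ y • wk k y) x = fderiv ℝ ψ x (wk k x) := by
    intro k hk x
    rw [divergence_smul_apply (hψd x) (hwkd k x)]
    by_cases hx : x ∈ tsupport ψ
    · rw [divergence_eq_traceCoord, htr0 k hk x hx, mul_zero, zero_add, real_inner_comm, gradient,
        InnerProductSpace.toDual_symm_apply]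
    · have hg0 : gradient ψ x = 0 := by simp [gradient, hDψ0 x hx]
      rw [hψ0 x hx, zero_mul, zero_add, hg0, inner_zero_right, hDψ0 x hx]
      simp
  have hderk : ∀ k, (bump k).rOut < δ → ∀ x i,
      fderiv ℝ (fun y => ψ y • wk k y) x (e i) = fderiv ℝ ψ x (e i) • wk k x + ψ x • Dki k i x := by
    intro k hk x i
    rw [fderiv_fun_smul (hψd x) (hwkd k x)]
    by_cases hx : x ∈ tsupport ψ
    · rw [← hfd k hk x hx i]
      simp only [_root_.add_apply, _root_.FunLike.coe_smul, Pi.smul_apply,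
        ContinuousLinearMap.smulRight_apply]
      rw [add_comm]
    · rw [hψ0 x hx, hDψ0 x hx]
      simp
  -- ### the smooth test fields `ψ wk` and their identities
  have htest : ∀ k, IsTestFunctionOn (⊤ : Opens (EuclideanSpace ℝ (Fin 3))) (fun y => ψ y • wk k y) :=
    fun k => ⟨hψ.contDiff.smul (hwk_smooth k), hψ.hasCompactSupport.smul_right, by simp⟩
  have hidk := ae_all_iff.2 fun k => h.ae_pairing_eq_datum_add_weak hT hm₀ hG (htest k)
  -- ### the cylinder `C = (0,T) × K` and the size of `G`, `v`, `π` on it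
  have hstrip : ((slab (EuclideanSpace ℝ (Fin 3)) (Ioo 0 T) isOpen_Ioo :
      Opens (ℝ × EuclideanSpace ℝ (Fin 3))) : Set (ℝ × EuclideanSpace ℝ (Fin 3))) = Ioo (0 : ℝ) T ×ˢ univ := rfl
  have hCm : MeasurableSet (Ioo (0 : ℝ) T ×ˢ K) := measurableSet_Ioo.prod hK.measurableSet
  have hCsub : Ioo (0 : ℝ) T ×ˢ K ⊆ Ioo 0 T ×ˢ (univ : Set (EuclideanSpace ℝ (Fin 3))) :=
    prod_mono Subset.rfl (subset_univ _)
  have hGmC : AEStronglyMeasurable (uncurry G) (volume.restrict (Ioo (0 : ℝ) T ×ˢ K)) := by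
    have h1 : AEStronglyMeasurable (uncurry G) (volume.restrict (Ioo (0 : ℝ) T ×ˢ univ)) := by
      rw [← hstrip]; exact hG.locallyIntegrableOn_grad.aestronglyMeasurable
    exact h1.mono_measure (Measure.restrict_mono hCsub le_rfl)
  have hvmC : AEStronglyMeasurable (uncurry v) (volume.restrict (Ioo (0 : ℝ) T ×ˢ K)) :=
    h.aestronglyMeasurable.mono_measure (Measure.restrict_mono hCsub le_rfl)
  have hπmC : AEStronglyMeasurable (uncurry π) (volume.restrict (Ioo (0 : ℝ) T ×ˢ K)) :=
    (h.integrableOn_pressure hK).aestronglyMeasurable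
  -- `AG = ∫∫_C |G|² < ∞`
  have hAG : ∫⁻ z in Ioo (0 : ℝ) T ×ˢ K, ‖G z.1 z.2‖ₑ ^ 2 < ∞ := by
    obtain ⟨G', hG', hG'b⟩ := h.uniformLocalGradient
    obtain ⟨C', hC'⟩ := hG'b (R + 1) (by linarith)
    have hKB' : K ⊆ ball (0 : EuclideanSpace ℝ (Fin 3)) (R + 1) := closedBall_subset_ball (by linarith)
    have hae : ∀ᵐ z ∂(volume.restrict (Ioo (0 : ℝ) T ×ˢ ball (0 : EuclideanSpace ℝ (Fin 3)) (R + 1))),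
        uncurry G z = uncurry G' z := by
      have h1 := hG.ae_eq hG'
      rw [hstrip] at h1
      exact ae_restrict_of_ae_restrict_of_subset (prod_mono Subset.rfl (subset_univ _)) h1
    calc ∫⁻ z in Ioo (0 : ℝ) T ×ˢ K, ‖G z.1 z.2‖ₑ ^ 2
        ≤ ∫⁻ z in Ioo (0 : ℝ) T ×ˢ ball (0 : EuclideanSpace ℝ (Fin 3)) (R + 1), ‖G z.1 z.2‖ₑ ^ 2 :=
          lintegral_mono_set (prod_mono Subset.rfl hKB')
      _ ≤ ∫⁻ z in Ioo (0 : ℝ) T ×ˢ ball (0 : EuclideanSpace ℝ (Fin 3)) (R + 1),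
            ENNReal.ofReal (frobeniusNormSq (G' z.1 z.2)) := by
          refine lintegral_mono_ae ?_
          filter_upwards [hae] with z hz
          rw [show G z.1 z.2 = uncurry G z from rfl, hz]
          exact enorm_opNorm_sq_le_ofReal_frobeniusNormSq (G' z.1 z.2)
      _ < ∞ := (hC' 0).trans_lt ENNReal.coe_lt_top
  have hAv3 : ∫⁻ z in Ioo (0 : ℝ) T ×ˢ K, ‖v z.1 z.2‖ₑ ^ 3 < ∞ :=
    (lintegral_mono_set (Set.prod_mono Subset.rfl (closedBall_subset_ball (by linarith)))).trans_lt
      (h.lintegral_cube_box_lt_top 0 (R + 1))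
  have hAπ : ∫⁻ z in Ioo (0 : ℝ) T ×ˢ K, ‖π z.1 z.2‖ₑ ^ (3 / 2 : ℝ) < ∞ := h.pressure K hK
  set AG : ℝ≥0∞ := ∫⁻ z in Ioo (0 : ℝ) T ×ˢ K, ‖G z.1 z.2‖ₑ ^ 2 with hAGdef
  set Av3 : ℝ≥0∞ := ∫⁻ z in Ioo (0 : ℝ) T ×ˢ K, ‖v z.1 z.2‖ₑ ^ 3 with hAv3def
  set Aπ : ℝ≥0∞ := ∫⁻ z in Ioo (0 : ℝ) T ×ˢ K, ‖π z.1 z.2‖ₑ ^ (3 / 2 : ℝ) with hAπdef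
  set VT : ℝ≥0∞ := volume (Ioo (0 : ℝ) T) with hVT
  have hVT' : VT ≠ ∞ := measure_Ioo_lt_top.ne
  -- ### the three weak-form integrands, for a field `u` on `ℝ³`
  -- pointwise bounds
  have hpt1 : ∀ (u : EuclideanSpace ℝ (Fin 3) → EuclideanSpace ℝ (Fin 3)) (z : ℝ × EuclideanSpace ℝ (Fin 3)),
      ‖⟪G z.1 z.2 (v z.1 z.2), ψ z.2 • u z.2⟫‖ₑ ≤
        ENNReal.ofReal Cψ * (‖G z.1 z.2‖ₑ * ‖v z.1 z.2‖ₑ * ‖u z.2‖ₑ) := by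
    intro u z
    rw [Real.enorm_eq_ofReal_abs, ← ofReal_norm, ← ofReal_norm, ← ofReal_norm,
      ← ENNReal.ofReal_mul (norm_nonneg _), ← ENNReal.ofReal_mul (by positivity),
      ← ENNReal.ofReal_mul hCψ0]
    refine ENNReal.ofReal_le_ofReal ?_
    calc |⟪G z.1 z.2 (v z.1 z.2), ψ z.2 • u z.2⟫| ≤ ‖G z.1 z.2 (v z.1 z.2)‖ * ‖ψ z.2 • u z.2‖ :=
          abs_real_inner_le_norm _ _
      _ ≤ (‖G z.1 z.2‖ * ‖v z.1 z.2‖) * (Cψ * ‖u z.2‖) := by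
          refine mul_le_mul (ContinuousLinearMap.le_opNorm _ _) ?_ (norm_nonneg _) (by positivity)
          rw [norm_smul]
          exact mul_le_mul_of_nonneg_right (hCψ z.2) (norm_nonneg _)
      _ = Cψ * (‖G z.1 z.2‖ * ‖v z.1 z.2‖ * ‖u z.2‖) := by ring
  have hpt2 : ∀ (u : EuclideanSpace ℝ (Fin 3) → EuclideanSpace ℝ (Fin 3)) (z : ℝ × EuclideanSpace ℝ (Fin 3)),
      ‖π z.1 z.2 * fderiv ℝ ψ z.2 (u z.2)‖ₑ ≤ ENNReal.ofReal CD * (‖π z.1 z.2‖ₑ * ‖u z.2‖ₑ) := by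
    intro u z
    rw [enorm_mul]
    have h1 : ‖fderiv ℝ ψ z.2 (u z.2)‖ₑ ≤ ENNReal.ofReal CD * ‖u z.2‖ₑ := by
      rw [← ofReal_norm, ← ofReal_norm (u z.2), ← ENNReal.ofReal_mul hCD0]
      exact ENNReal.ofReal_le_ofReal ((ContinuousLinearMap.le_opNorm _ _).trans
        (mul_le_mul_of_nonneg_right (hCD z.2) (norm_nonneg _)))
    calc ‖π z.1 z.2‖ₑ * ‖fderiv ℝ ψ z.2 (u z.2)‖ₑ ≤ ‖π z.1 z.2‖ₑ * (ENNReal.ofReal CD * ‖u z.2‖ₑ) :=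
          mul_le_mul' le_rfl h1
      _ = ENNReal.ofReal CD * (‖π z.1 z.2‖ₑ * ‖u z.2‖ₑ) := by ring
  have hpt3 : ∀ (u : EuclideanSpace ℝ (Fin 3) → EuclideanSpace ℝ (Fin 3))
      (Dv : Fin (Module.finrank ℝ (EuclideanSpace ℝ (Fin 3))) → EuclideanSpace ℝ (Fin 3) → EuclideanSpace ℝ (Fin 3))
      (z : ℝ × EuclideanSpace ℝ (Fin 3)),
      ‖∑ i, ⟪G z.1 z.2 (e i), fderiv ℝ ψ z.2 (e i) • u z.2 + ψ z.2 • Dv i z.2⟫‖ₑ ≤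
        ∑ i, ‖G z.1 z.2‖ₑ * (ENNReal.ofReal CD * ‖u z.2‖ₑ + ENNReal.ofReal Cψ * ‖Dv i z.2‖ₑ) := by
    intro u Dv z
    refine (enorm_sum_le _ _).trans (Finset.sum_le_sum fun i _ => ?_)
    rw [Real.enorm_eq_ofReal_abs, ← ofReal_norm (G z.1 z.2), ← ofReal_norm (u z.2), ← ofReal_norm (Dv i z.2),
      ← ENNReal.ofReal_mul hCD0, ← ENNReal.ofReal_mul hCψ0,
      ← ENNReal.ofReal_add (by positivity) (by positivity), ← ENNReal.ofReal_mul (norm_nonneg _)]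
    refine ENNReal.ofReal_le_ofReal ?_
    have he1 : ‖e i‖ = 1 := e.orthonormal.1 i
    calc |⟪G z.1 z.2 (e i), fderiv ℝ ψ z.2 (e i) • u z.2 + ψ z.2 • Dv i z.2⟫|
        ≤ ‖G z.1 z.2 (e i)‖ * ‖fderiv ℝ ψ z.2 (e i) • u z.2 + ψ z.2 • Dv i z.2‖ := abs_real_inner_le_norm _ _
      _ ≤ ‖G z.1 z.2‖ * (CD * ‖u z.2‖ + Cψ * ‖Dv i z.2‖) := by
          refine mul_le_mul ((ContinuousLinearMap.le_opNorm _ _).trans (by rw [he1, mul_one]))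
            ((norm_add_le _ _).trans (add_le_add ?_ ?_)) (norm_nonneg _) (norm_nonneg _)
          · rw [norm_smul]
            exact mul_le_mul_of_nonneg_right ((ContinuousLinearMap.le_opNorm _ _).trans
              (by rw [he1, mul_one]; exact hCD z.2)) (norm_nonneg _)
          · rw [norm_smul]
            exact mul_le_mul_of_nonneg_right (hCψ z.2) (norm_nonneg _)
  -- measurability of space fields lifted to the cylinder
  have hlift : ∀ {F' : Type} [NormedAddCommGroup F'] {u : EuclideanSpace ℝ (Fin 3) → F'},
      AEStronglyMeasurable u volume →
      AEStronglyMeasurable (fun z : ℝ × EuclideanSpace ℝ (Fin 3) => u z.2) (volume.restrict (Ioo (0 : ℝ) T ×ˢ K)) := by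
    intro F' _ u hu
    have h1 : AEStronglyMeasurable (fun z : ℝ × EuclideanSpace ℝ (Fin 3) => u z.2)
        (volume : Measure (ℝ × EuclideanSpace ℝ (Fin 3))) := by
      rw [Measure.volume_eq_prod]
      exact hu.comp_quasiMeasurePreserving Measure.quasiMeasurePreserving_snd
    exact h1.mono_measure Measure.restrict_le_self
  have hliftK : ∀ (g : EuclideanSpace ℝ (Fin 3) → ℝ≥0∞), AEMeasurable g volume →
      AEMeasurable g (volume.restrict K) := fun g hg => hg.restrict
  have hGvm : AEStronglyMeasurable (fun z : ℝ × EuclideanSpace ℝ (Fin 3) => G z.1 z.2 (v z.1 z.2))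
      (volume.restrict (Ioo (0 : ℝ) T ×ˢ K)) := aestronglyMeasurable_clm_apply_fin3 hGmC hvmC
  have hGem : ∀ i, AEStronglyMeasurable (fun z : ℝ × EuclideanSpace ℝ (Fin 3) => G z.1 z.2 (e i))
      (volume.restrict (Ioo (0 : ℝ) T ×ˢ K)) := fun i => hGmC.apply_continuousLinearMap (e i)
  have hψm : AEStronglyMeasurable (fun z : ℝ × EuclideanSpace ℝ (Fin 3) => ψ z.2)
      (volume.restrict (Ioo (0 : ℝ) T ×ˢ K)) := (hψc.comp continuous_snd).aestronglyMeasurable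
  have hDψm : ∀ a : EuclideanSpace ℝ (Fin 3), Continuous fun x : EuclideanSpace ℝ (Fin 3) => fderiv ℝ ψ x a :=
    fun a => hDψc.clm_apply continuous_const
  -- finiteness of the fixed sizes
  have hAGtop : AG ^ (1 / 2 : ℝ) ≠ ∞ := ENNReal.rpow_ne_top_of_nonneg (by norm_num) hAG.ne
  have hAv3top : Av3 ^ (1 / 3 : ℝ) ≠ ∞ := ENNReal.rpow_ne_top_of_nonneg (by norm_num) hAv3.ne
  have hAπtop : Aπ ^ (2 / 3 : ℝ) ≠ ∞ := ENNReal.rpow_ne_top_of_nonneg (by norm_num) hAπ.ne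
  -- ### (Int1) the trilinear integrand
  have hInt1 : ∀ {u : EuclideanSpace ℝ (Fin 3) → EuclideanSpace ℝ (Fin 3)}, AEStronglyMeasurable u volume →
      ∫⁻ x in K, ‖u x‖ₑ ^ 6 ≠ ∞ →
      IntegrableOn (fun z : ℝ × EuclideanSpace ℝ (Fin 3) => ⟪G z.1 z.2 (v z.1 z.2), ψ z.2 • u z.2⟫)
          (Ioo (0 : ℝ) T ×ˢ K) volume ∧
        ∫⁻ z in Ioo (0 : ℝ) T ×ˢ K, ‖⟪G z.1 z.2 (v z.1 z.2), ψ z.2 • u z.2⟫‖ₑ ≤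
          ENNReal.ofReal Cψ * (AG ^ (1 / 2 : ℝ) * Av3 ^ (1 / 3 : ℝ) * (VT * ∫⁻ x in K, ‖u x‖ₑ ^ 6) ^ (1 / 6 : ℝ)) := by
    intro u hu hu6
    have hm : AEStronglyMeasurable (fun z : ℝ × EuclideanSpace ℝ (Fin 3) => ⟪G z.1 z.2 (v z.1 z.2), ψ z.2 • u z.2⟫)
        (volume.restrict (Ioo (0 : ℝ) T ×ˢ K)) := hGvm.inner (hψm.smul (hlift hu))
    have hbound : ∫⁻ z in Ioo (0 : ℝ) T ×ˢ K, ‖⟪G z.1 z.2 (v z.1 z.2), ψ z.2 • u z.2⟫‖ₑ ≤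
        ENNReal.ofReal Cψ * (AG ^ (1 / 2 : ℝ) * Av3 ^ (1 / 3 : ℝ) * (VT * ∫⁻ x in K, ‖u x‖ₑ ^ 6) ^ (1 / 6 : ℝ)) := by
      calc ∫⁻ z in Ioo (0 : ℝ) T ×ˢ K, ‖⟪G z.1 z.2 (v z.1 z.2), ψ z.2 • u z.2⟫‖ₑ
          ≤ ∫⁻ z in Ioo (0 : ℝ) T ×ˢ K, ENNReal.ofReal Cψ * (‖G z.1 z.2‖ₑ * ‖v z.1 z.2‖ₑ * ‖u z.2‖ₑ) :=
            lintegral_mono fun z => hpt1 u z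
        _ = ENNReal.ofReal Cψ * ∫⁻ z in Ioo (0 : ℝ) T ×ˢ K, ‖G z.1 z.2‖ₑ * ‖v z.1 z.2‖ₑ * ‖u z.2‖ₑ :=
            lintegral_const_mul' _ _ ENNReal.ofReal_ne_top
        _ ≤ ENNReal.ofReal Cψ * (AG ^ (1 / 2 : ℝ) * Av3 ^ (1 / 3 : ℝ) *
              (∫⁻ z in Ioo (0 : ℝ) T ×ˢ K, ‖u z.2‖ₑ ^ 6) ^ (1 / 6 : ℝ)) := by
            refine mul_le_mul' le_rfl ?_
            exact lintegral_mul_mul_le_L2_L3_L6 hGmC.enorm hvmC.enorm (hlift hu).enorm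
        _ = _ := by rw [lintegral_cylinder_comp_snd (fun x => ‖u x‖ₑ ^ 6) (hu.enorm.pow_const 6).restrict]
    refine ⟨⟨hm, ?_⟩, hbound⟩
    rw [hasFiniteIntegral_iff_enorm]
    refine lt_of_le_of_lt hbound (ENNReal.mul_lt_top ENNReal.ofReal_lt_top ?_)
    refine ENNReal.mul_lt_top (ENNReal.mul_lt_top hAGtop.lt_top hAv3top.lt_top) ?_
    exact (ENNReal.rpow_ne_top_of_nonneg (by norm_num) (ENNReal.mul_ne_top hVT' hu6)).lt_top
  -- ### (Int2) the pressure integrand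
  have hInt2 : ∀ {u : EuclideanSpace ℝ (Fin 3) → EuclideanSpace ℝ (Fin 3)}, AEStronglyMeasurable u volume →
      ∫⁻ x in K, ‖u x‖ₑ ^ 3 ≠ ∞ →
      IntegrableOn (fun z : ℝ × EuclideanSpace ℝ (Fin 3) => π z.1 z.2 * fderiv ℝ ψ z.2 (u z.2))
          (Ioo (0 : ℝ) T ×ˢ K) volume ∧
        ∫⁻ z in Ioo (0 : ℝ) T ×ˢ K, ‖π z.1 z.2 * fderiv ℝ ψ z.2 (u z.2)‖ₑ ≤
          ENNReal.ofReal CD * (Aπ ^ (2 / 3 : ℝ) * (VT * ∫⁻ x in K, ‖u x‖ₑ ^ 3) ^ (1 / 3 : ℝ)) := by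
    intro u hu hu3
    have hm : AEStronglyMeasurable (fun z : ℝ × EuclideanSpace ℝ (Fin 3) => π z.1 z.2 * fderiv ℝ ψ z.2 (u z.2))
        (volume.restrict (Ioo (0 : ℝ) T ×ˢ K)) :=
      hπmC.mul ((isBoundedBilinearMap_apply (𝕜 := ℝ) (E := EuclideanSpace ℝ (Fin 3)) (F := ℝ)).continuous.comp_aestronglyMeasurable
        (((hDψc.comp continuous_snd).aestronglyMeasurable).prodMk (hlift hu)))
    have hbound : ∫⁻ z in Ioo (0 : ℝ) T ×ˢ K, ‖π z.1 z.2 * fderiv ℝ ψ z.2 (u z.2)‖ₑ ≤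
        ENNReal.ofReal CD * (Aπ ^ (2 / 3 : ℝ) * (VT * ∫⁻ x in K, ‖u x‖ₑ ^ 3) ^ (1 / 3 : ℝ)) := by
      calc ∫⁻ z in Ioo (0 : ℝ) T ×ˢ K, ‖π z.1 z.2 * fderiv ℝ ψ z.2 (u z.2)‖ₑ
          ≤ ∫⁻ z in Ioo (0 : ℝ) T ×ˢ K, ENNReal.ofReal CD * (‖π z.1 z.2‖ₑ * ‖u z.2‖ₑ) :=
            lintegral_mono fun z => hpt2 u z
        _ = ENNReal.ofReal CD * ∫⁻ z in Ioo (0 : ℝ) T ×ˢ K, ‖π z.1 z.2‖ₑ * ‖u z.2‖ₑ :=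
            lintegral_const_mul' _ _ ENNReal.ofReal_ne_top
        _ ≤ ENNReal.ofReal CD * (Aπ ^ (2 / 3 : ℝ) * (∫⁻ z in Ioo (0 : ℝ) T ×ˢ K, ‖u z.2‖ₑ ^ 3) ^ (1 / 3 : ℝ)) :=
            mul_le_mul' le_rfl (lintegral_mul_le_L32_L3 hπmC.enorm (hlift hu).enorm)
        _ = _ := by rw [lintegral_cylinder_comp_snd (fun x => ‖u x‖ₑ ^ 3) (hu.enorm.pow_const 3).restrict]
    refine ⟨⟨hm, ?_⟩, hbound⟩
    rw [hasFiniteIntegral_iff_enorm]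
    refine lt_of_le_of_lt hbound (ENNReal.mul_lt_top ENNReal.ofReal_lt_top ?_)
    refine ENNReal.mul_lt_top hAπtop.lt_top ?_
    exact (ENNReal.rpow_ne_top_of_nonneg (by norm_num) (ENNReal.mul_ne_top hVT' hu3)).lt_top
  -- ### (Int3) the viscous integrand
  have hInt3 : ∀ {u : EuclideanSpace ℝ (Fin 3) → EuclideanSpace ℝ (Fin 3)}
      {Dv : Fin (Module.finrank ℝ (EuclideanSpace ℝ (Fin 3))) → EuclideanSpace ℝ (Fin 3) → EuclideanSpace ℝ (Fin 3)},
      AEStronglyMeasurable u volume → (∀ i, AEStronglyMeasurable (Dv i) volume) →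
      ∫⁻ x in K, ‖u x‖ₑ ^ 2 ≠ ∞ → (∀ i, ∫⁻ x in K, ‖Dv i x‖ₑ ^ 2 ≠ ∞) →
      IntegrableOn (fun z : ℝ × EuclideanSpace ℝ (Fin 3) =>
          ∑ i, ⟪G z.1 z.2 (e i), fderiv ℝ ψ z.2 (e i) • u z.2 + ψ z.2 • Dv i z.2⟫) (Ioo (0 : ℝ) T ×ˢ K) volume ∧
        ∫⁻ z in Ioo (0 : ℝ) T ×ˢ K, ‖∑ i, ⟪G z.1 z.2 (e i), fderiv ℝ ψ z.2 (e i) • u z.2 + ψ z.2 • Dv i z.2⟫‖ₑ ≤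
          ∑ i, AG ^ (1 / 2 : ℝ) * (ENNReal.ofReal CD * (VT * ∫⁻ x in K, ‖u x‖ₑ ^ 2) ^ (1 / 2 : ℝ) +
            ENNReal.ofReal Cψ * (VT * ∫⁻ x in K, ‖Dv i x‖ₑ ^ 2) ^ (1 / 2 : ℝ)) := by
    intro u Dv hu hDv hu2 hDv2
    have hm : AEStronglyMeasurable (fun z : ℝ × EuclideanSpace ℝ (Fin 3) =>
        ∑ i, ⟪G z.1 z.2 (e i), fderiv ℝ ψ z.2 (e i) • u z.2 + ψ z.2 • Dv i z.2⟫)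
        (volume.restrict (Ioo (0 : ℝ) T ×ˢ K)) := by
      have hi : ∀ i, AEStronglyMeasurable (fun z : ℝ × EuclideanSpace ℝ (Fin 3) =>
          ⟪G z.1 z.2 (e i), fderiv ℝ ψ z.2 (e i) • u z.2 + ψ z.2 • Dv i z.2⟫) (volume.restrict (Ioo (0 : ℝ) T ×ˢ K)) :=
        fun i => (hGem i).inner ((((hDψm (e i)).comp continuous_snd).aestronglyMeasurable.smul (hlift hu)).add
          (hψm.smul (hlift (hDv i))))
      have hh := Finset.aestronglyMeasurable_sum (Finset.univ)
        (f := fun i (z : ℝ × EuclideanSpace ℝ (Fin 3)) => ⟪G z.1 z.2 (e i), fderiv ℝ ψ z.2 (e i) • u z.2 + ψ z.2 • Dv i z.2⟫)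
        fun i _ => hi i
      have ee : (∑ i, fun (z : ℝ × EuclideanSpace ℝ (Fin 3)) =>
          ⟪G z.1 z.2 (e i), fderiv ℝ ψ z.2 (e i) • u z.2 + ψ z.2 • Dv i z.2⟫) =
          fun z => ∑ i, ⟪G z.1 z.2 (e i), fderiv ℝ ψ z.2 (e i) • u z.2 + ψ z.2 • Dv i z.2⟫ := by
        funext z; simp only [Finset.sum_apply]
      rw [ee] at hh
      exact hh
    have hterm : ∀ i, ∫⁻ z in Ioo (0 : ℝ) T ×ˢ K,
        ‖G z.1 z.2‖ₑ * (ENNReal.ofReal CD * ‖u z.2‖ₑ + ENNReal.ofReal Cψ * ‖Dv i z.2‖ₑ) ≤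
        AG ^ (1 / 2 : ℝ) * (ENNReal.ofReal CD * (VT * ∫⁻ x in K, ‖u x‖ₑ ^ 2) ^ (1 / 2 : ℝ) +
          ENNReal.ofReal Cψ * (VT * ∫⁻ x in K, ‖Dv i x‖ₑ ^ 2) ^ (1 / 2 : ℝ)) := by
      intro i
      have hmu : AEMeasurable (fun z : ℝ × EuclideanSpace ℝ (Fin 3) => ENNReal.ofReal CD * ‖u z.2‖ₑ)
          (volume.restrict (Ioo (0 : ℝ) T ×ˢ K)) := (hlift hu).enorm.const_mul _
      calc ∫⁻ z in Ioo (0 : ℝ) T ×ˢ K, ‖G z.1 z.2‖ₑ * (ENNReal.ofReal CD * ‖u z.2‖ₑ + ENNReal.ofReal Cψ * ‖Dv i z.2‖ₑ)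
          = (∫⁻ z in Ioo (0 : ℝ) T ×ˢ K, ‖G z.1 z.2‖ₑ * (ENNReal.ofReal CD * ‖u z.2‖ₑ)) +
              ∫⁻ z in Ioo (0 : ℝ) T ×ˢ K, ‖G z.1 z.2‖ₑ * (ENNReal.ofReal Cψ * ‖Dv i z.2‖ₑ) := by
            simp only [mul_add]
            exact lintegral_add_left' (hGmC.enorm.mul hmu) _
        _ = ENNReal.ofReal CD * (∫⁻ z in Ioo (0 : ℝ) T ×ˢ K, ‖G z.1 z.2‖ₑ * ‖u z.2‖ₑ) +
              ENNReal.ofReal Cψ * ∫⁻ z in Ioo (0 : ℝ) T ×ˢ K, ‖G z.1 z.2‖ₑ * ‖Dv i z.2‖ₑ := by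
            rw [← lintegral_const_mul' _ _ ENNReal.ofReal_ne_top, ← lintegral_const_mul' _ _ ENNReal.ofReal_ne_top]
            congr 1 <;> exact lintegral_congr fun z => by ring
        _ ≤ ENNReal.ofReal CD * (AG ^ (1 / 2 : ℝ) * (∫⁻ z in Ioo (0 : ℝ) T ×ˢ K, ‖u z.2‖ₑ ^ 2) ^ (1 / 2 : ℝ)) +
              ENNReal.ofReal Cψ * (AG ^ (1 / 2 : ℝ) * (∫⁻ z in Ioo (0 : ℝ) T ×ˢ K, ‖Dv i z.2‖ₑ ^ 2) ^ (1 / 2 : ℝ)) :=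
            add_le_add (mul_le_mul' le_rfl (lintegral_mul_le_L2_L2 hGmC.enorm (hlift hu).enorm))
              (mul_le_mul' le_rfl (lintegral_mul_le_L2_L2 hGmC.enorm (hlift (hDv i)).enorm))
        _ = _ := by
            rw [lintegral_cylinder_comp_snd (fun x => ‖u x‖ₑ ^ 2) (hu.enorm.pow_const 2).restrict,
              lintegral_cylinder_comp_snd (fun x => ‖Dv i x‖ₑ ^ 2) ((hDv i).enorm.pow_const 2).restrict]
            ring
    have hbound : ∫⁻ z in Ioo (0 : ℝ) T ×ˢ K, ‖∑ i, ⟪G z.1 z.2 (e i), fderiv ℝ ψ z.2 (e i) • u z.2 + ψ z.2 • Dv i z.2⟫‖ₑ ≤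
        ∑ i, AG ^ (1 / 2 : ℝ) * (ENNReal.ofReal CD * (VT * ∫⁻ x in K, ‖u x‖ₑ ^ 2) ^ (1 / 2 : ℝ) +
          ENNReal.ofReal Cψ * (VT * ∫⁻ x in K, ‖Dv i x‖ₑ ^ 2) ^ (1 / 2 : ℝ)) := by
      calc ∫⁻ z in Ioo (0 : ℝ) T ×ˢ K, ‖∑ i, ⟪G z.1 z.2 (e i), fderiv ℝ ψ z.2 (e i) • u z.2 + ψ z.2 • Dv i z.2⟫‖ₑ
          ≤ ∫⁻ z in Ioo (0 : ℝ) T ×ˢ K, ∑ i, ‖G z.1 z.2‖ₑ * (ENNReal.ofReal CD * ‖u z.2‖ₑ + ENNReal.ofReal Cψ * ‖Dv i z.2‖ₑ) :=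
            lintegral_mono fun z => hpt3 u Dv z
        _ = ∑ i, ∫⁻ z in Ioo (0 : ℝ) T ×ˢ K, ‖G z.1 z.2‖ₑ * (ENNReal.ofReal CD * ‖u z.2‖ₑ + ENNReal.ofReal Cψ * ‖Dv i z.2‖ₑ) := by
            refine lintegral_finsetSum' _ fun i _ => ?_
            exact hGmC.enorm.mul (((hlift hu).enorm.const_mul _).add ((hlift (hDv i)).enorm.const_mul _))
        _ ≤ _ := Finset.sum_le_sum fun i _ => hterm i
    refine ⟨⟨hm, ?_⟩, hbound⟩
    rw [hasFiniteIntegral_iff_enorm]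
    refine lt_of_le_of_lt hbound (ENNReal.sum_lt_top.2 fun i _ => ENNReal.mul_lt_top hAGtop.lt_top ?_)
    refine ENNReal.add_lt_top.2 ⟨ENNReal.mul_lt_top ENNReal.ofReal_lt_top ?_, ENNReal.mul_lt_top ENNReal.ofReal_lt_top ?_⟩
    · exact (ENNReal.rpow_ne_top_of_nonneg (by norm_num) (ENNReal.mul_ne_top hVT' hu2)).lt_top
    · exact (ENNReal.rpow_ne_top_of_nonneg (by norm_num) (ENNReal.mul_ne_top hVT' (hDv2 i))).lt_top
  -- ### from the cylinder to the product measures `dt|_(0,t] ⊗ dx`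
  have hvan_of : ∀ {f : ℝ × EuclideanSpace ℝ (Fin 3) → ℝ}, (∀ z : ℝ × EuclideanSpace ℝ (Fin 3), z.2 ∉ K → f z = 0) →
      IntegrableOn f (Ioo (0 : ℝ) T ×ˢ K) volume → ∀ {t : ℝ}, t < T →
      Integrable f (((volume : Measure ℝ).restrict (Ioc 0 t)).prod (volume : Measure (EuclideanSpace ℝ (Fin 3)))) := by
    intro f hf0 hfC t ht
    have h1 : IntegrableOn f (Ioo (0 : ℝ) T ×ˢ (univ : Set (EuclideanSpace ℝ (Fin 3)))) volume :=
      hfC.of_forall_sdiff_eq_zero (measurableSet_Ioo.prod MeasurableSet.univ) fun z hz =>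
        hf0 z fun hK' => hz.2 ⟨hz.1.1, hK'⟩
    have h2 : IntegrableOn f (Ioc (0 : ℝ) t ×ˢ (univ : Set (EuclideanSpace ℝ (Fin 3)))) volume :=
      h1.mono_set (prod_mono (fun s hs => ⟨hs.1, lt_of_le_of_lt hs.2 ht⟩) Subset.rfl)
    rw [Measure.restrict_prod_eq_prod_univ, ← Measure.volume_eq_prod]
    exact h2
  have hlin_of : ∀ {t : ℝ} {f : ℝ × EuclideanSpace ℝ (Fin 3) → ℝ}, (∀ z : ℝ × EuclideanSpace ℝ (Fin 3), z.2 ∉ K → f z = 0) →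
      t < T →
      ∫⁻ z, ‖f z‖ₑ ∂(((volume : Measure ℝ).restrict (Ioc 0 t)).prod (volume : Measure (EuclideanSpace ℝ (Fin 3)))) ≤
        ∫⁻ z in Ioo (0 : ℝ) T ×ˢ K, ‖f z‖ₑ := by
    intro t f hf0 ht
    rw [Measure.restrict_prod_eq_prod_univ, ← Measure.volume_eq_prod]
    calc ∫⁻ z in Ioc (0 : ℝ) t ×ˢ (univ : Set (EuclideanSpace ℝ (Fin 3))), ‖f z‖ₑ
        ≤ ∫⁻ z in Ioc (0 : ℝ) t ×ˢ (univ : Set (EuclideanSpace ℝ (Fin 3))), (Ioo (0 : ℝ) T ×ˢ K).indicator (fun z => ‖f z‖ₑ) z := by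
          refine setLIntegral_mono' (measurableSet_Ioc.prod MeasurableSet.univ) fun z hz => ?_
          by_cases hzK : z.2 ∈ K
          · rw [indicator_of_mem (show z ∈ Ioo (0 : ℝ) T ×ˢ K from ⟨⟨hz.1.1, lt_of_le_of_lt hz.1.2 ht⟩, hzK⟩)]
          · rw [hf0 z hzK, enorm_zero]; exact bot_le
      _ ≤ ∫⁻ z, (Ioo (0 : ℝ) T ×ˢ K).indicator (fun z => ‖f z‖ₑ) z := lintegral_mono' Measure.restrict_le_self le_rfl
      _ = ∫⁻ z in Ioo (0 : ℝ) T ×ˢ K, ‖f z‖ₑ := lintegral_indicator hCm _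
  -- Fubini for the bulk functional
  have hPhi : ∀ {t : ℝ} {f₁ f₂ f₃ : ℝ × EuclideanSpace ℝ (Fin 3) → ℝ},
      Integrable f₁ (((volume : Measure ℝ).restrict (Ioc 0 t)).prod (volume : Measure (EuclideanSpace ℝ (Fin 3)))) →
      Integrable f₂ (((volume : Measure ℝ).restrict (Ioc 0 t)).prod (volume : Measure (EuclideanSpace ℝ (Fin 3)))) →
      Integrable f₃ (((volume : Measure ℝ).restrict (Ioc 0 t)).prod (volume : Measure (EuclideanSpace ℝ (Fin 3)))) →
      ∫ s in Ioc 0 t, (((-∫ x, f₁ (s, x)) + ∫ x, f₂ (s, x)) - ν * ∫ x, f₃ (s, x)) =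
        ((-∫ z, f₁ z ∂(((volume : Measure ℝ).restrict (Ioc 0 t)).prod (volume : Measure (EuclideanSpace ℝ (Fin 3))))) +
          ∫ z, f₂ z ∂(((volume : Measure ℝ).restrict (Ioc 0 t)).prod (volume : Measure (EuclideanSpace ℝ (Fin 3))))) -
        ν * ∫ z, f₃ z ∂(((volume : Measure ℝ).restrict (Ioc 0 t)).prod (volume : Measure (EuclideanSpace ℝ (Fin 3)))) := by
    intro t f₁ f₂ f₃ h₁ h₂ h₃
    rw [integral_prod _ h₁, integral_prod _ h₂, integral_prod _ h₃]
    have i₁ := h₁.integral_prod_left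
    have i₂ := h₂.integral_prod_left
    have i₃ := h₃.integral_prod_left
    have iN : Integrable (fun s => -∫ x, f₁ (s, x)) ((volume : Measure ℝ).restrict (Ioc 0 t)) := i₁.neg
    have iA : Integrable (fun s => (-∫ x, f₁ (s, x)) + ∫ x, f₂ (s, x)) ((volume : Measure ℝ).restrict (Ioc 0 t)) :=
      iN.add i₂
    have iB : Integrable (fun s => ν * ∫ x, f₃ (s, x)) ((volume : Measure ℝ).restrict (Ioc 0 t)) := i₃.const_mul ν
    rw [integral_sub iA iB, integral_add iN i₂, integral_neg, integral_const_mul]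
  -- ### space pairings `∫ ⟪q, ψ u⟫` with an `L²(K)` field `q`
  have hpair : ∀ {q : EuclideanSpace ℝ (Fin 3) → EuclideanSpace ℝ (Fin 3)},
      AEStronglyMeasurable q (volume.restrict K) → ∫⁻ x in K, ‖q x‖ₑ ^ 2 ≠ ∞ →
      ∀ {u : EuclideanSpace ℝ (Fin 3) → EuclideanSpace ℝ (Fin 3)}, AEStronglyMeasurable u volume →
      ∫⁻ x in K, ‖u x‖ₑ ^ 2 ≠ ∞ →
      Integrable (fun x => ⟪q x, ψ x • u x⟫) volume ∧
        ‖∫ x, ⟪q x, ψ x • u x⟫‖ₑ ≤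
          ENNReal.ofReal Cψ * ((∫⁻ x in K, ‖q x‖ₑ ^ 2) ^ (1 / 2 : ℝ) * (∫⁻ x in K, ‖u x‖ₑ ^ 2) ^ (1 / 2 : ℝ)) := by
    intro q hqm hq2 u hum hu2
    have hpt : ∀ x, ‖⟪q x, ψ x • u x⟫‖ₑ ≤ ENNReal.ofReal Cψ * (‖q x‖ₑ * ‖u x‖ₑ) := by
      intro x
      rw [Real.enorm_eq_ofReal_abs, ← ofReal_norm, ← ofReal_norm, ← ENNReal.ofReal_mul (norm_nonneg _),
        ← ENNReal.ofReal_mul hCψ0]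
      refine ENNReal.ofReal_le_ofReal ?_
      calc |⟪q x, ψ x • u x⟫| ≤ ‖q x‖ * ‖ψ x • u x‖ := abs_real_inner_le_norm _ _
        _ ≤ ‖q x‖ * (Cψ * ‖u x‖) := by
            refine mul_le_mul_of_nonneg_left ?_ (norm_nonneg _)
            rw [norm_smul]
            exact mul_le_mul_of_nonneg_right (hCψ x) (norm_nonneg _)
        _ = Cψ * (‖q x‖ * ‖u x‖) := by ring
    have h0 : ∀ x, x ∉ K → ⟪q x, ψ x • u x⟫ = 0 := fun x hx => by
      rw [hψ0 x (fun h' => hx (hBK (hψK h'))), zero_smul, inner_zero_right]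
    have humK : AEStronglyMeasurable u (volume.restrict K) := hum.restrict
    have hq2I : IntegrableOn (fun x => ‖q x‖ ^ 2) K volume := by
      refine ⟨(hqm.norm.pow 2), ?_⟩
      rw [hasFiniteIntegral_iff_enorm]
      refine lt_of_le_of_lt (lintegral_mono fun x => le_of_eq ?_) hq2.lt_top
      rw [Real.enorm_eq_ofReal (sq_nonneg _), ← ofReal_norm, ENNReal.ofReal_pow (norm_nonneg _)]
    have hu2I : IntegrableOn (fun x => ‖u x‖ ^ 2) K volume := by
      refine ⟨(humK.norm.pow 2), ?_⟩
      rw [hasFiniteIntegral_iff_enorm]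
      refine lt_of_le_of_lt (lintegral_mono fun x => le_of_eq ?_) hu2.lt_top
      rw [Real.enorm_eq_ofReal (sq_nonneg _), ← ofReal_norm, ENNReal.ofReal_pow (norm_nonneg _)]
    have hIK : IntegrableOn (fun x => ⟪q x, ψ x • u x⟫) K volume := by
      refine Integrable.mono' ((integrable_norm_mul_norm_of_sq hqm humK hq2I hu2I).const_mul Cψ)
        (hqm.inner ((hψc.aestronglyMeasurable.restrict).smul humK)) (Eventually.of_forall fun x => ?_)
      calc ‖⟪q x, ψ x • u x⟫‖ ≤ ‖q x‖ * ‖ψ x • u x‖ := norm_inner_le_norm _ _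
        _ ≤ ‖q x‖ * (Cψ * ‖u x‖) := by
            refine mul_le_mul_of_nonneg_left ?_ (norm_nonneg _)
            rw [norm_smul]
            exact mul_le_mul_of_nonneg_right (hCψ x) (norm_nonneg _)
        _ = Cψ * (‖q x‖ * ‖u x‖) := by ring
    have hI : Integrable (fun x => ⟪q x, ψ x • u x⟫) volume := hIK.integrable_of_forall_notMem_eq_zero h0
    refine ⟨hI, ?_⟩
    calc ‖∫ x, ⟪q x, ψ x • u x⟫‖ₑ ≤ ∫⁻ x, ‖⟪q x, ψ x • u x⟫‖ₑ := enorm_integral_le_lintegral_enorm _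
      _ = ∫⁻ x in K, ‖⟪q x, ψ x • u x⟫‖ₑ := by
          rw [← lintegral_indicator hK.measurableSet]
          refine lintegral_congr fun x => ?_
          by_cases hx : x ∈ K
          · rw [indicator_of_mem hx]
          · rw [indicator_of_notMem hx, h0 x hx, enorm_zero]
      _ ≤ ∫⁻ x in K, ENNReal.ofReal Cψ * (‖q x‖ₑ * ‖u x‖ₑ) := lintegral_mono fun x => hpt x
      _ = ENNReal.ofReal Cψ * ∫⁻ x in K, ‖q x‖ₑ * ‖u x‖ₑ := lintegral_const_mul' _ _ ENNReal.ofReal_ne_top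
      _ ≤ _ := mul_le_mul' le_rfl (lintegral_mul_le_L2_L2 hqm.enorm humK.enorm)
  -- ### sizes of the approximating fields on `K`
  have hsizeP : ∀ (f : EuclideanSpace ℝ (Fin 3) → EuclideanSpace ℝ (Fin 3)) {n : ℕ}, n ≠ 0 → MemLp f n volume →
      ∫⁻ x in K, ‖f x‖ₑ ^ n ≠ ∞ := fun f n hn hf =>
    ne_top_of_le_ne_top (ENNReal.pow_ne_top hf.eLpNorm_ne_top) (setLIntegral_pow_enorm_le_eLpNorm_pow f K hn)
  have hwkm : ∀ k, AEStronglyMeasurable (wk k) volume := fun k => (hwk_smooth k).continuous.aestronglyMeasurable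
  have hwtm : AEStronglyMeasurable wt volume := hwt6.1
  have hGtim : ∀ i, AEStronglyMeasurable (Gti i) volume := fun i => (hGti2 i).1
  have hDkim : ∀ k i, AEStronglyMeasurable (Dki k i) volume := fun k i => (hDki_cont k i).aestronglyMeasurable
  have hwk6K : ∀ k, ∫⁻ x in K, ‖wk k x‖ₑ ^ 6 ≠ ∞ := fun k =>
    hsizeP (wk k) (by norm_num) (by simpa using hwk6 k)
  have hwk3K : ∀ k, ∫⁻ x in K, ‖wk k x‖ₑ ^ 3 ≠ ∞ := fun k =>
    hsizeP (wk k) (by norm_num) (by simpa using hwk3 k)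
  have hwk2K : ∀ k, ∫⁻ x in K, ‖wk k x‖ₑ ^ 2 ≠ ∞ := fun k =>
    hsizeP (wk k) (by norm_num) (by simpa using hwk2 k)
  have hwt6K : ∫⁻ x in K, ‖wt x‖ₑ ^ 6 ≠ ∞ := hsizeP wt (by norm_num) (by simpa using hwt6)
  have hwt3K : ∫⁻ x in K, ‖wt x‖ₑ ^ 3 ≠ ∞ := hsizeP wt (by norm_num) (by simpa using hwt3)
  have hwt2K : ∫⁻ x in K, ‖wt x‖ₑ ^ 2 ≠ ∞ := hsizeP wt (by norm_num) (by simpa using hwt2)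
  have hGti2K : ∀ i, ∫⁻ x in K, ‖Gti i x‖ₑ ^ 2 ≠ ∞ := fun i => hsizeP (Gti i) (by norm_num) (by simpa using hGti2 i)
  have hDki2K : ∀ k i, ∫⁻ x in K, ‖Dki k i x‖ₑ ^ 2 ≠ ∞ := fun k i =>
    hsizeP (Dki k i) (by norm_num) (by simpa using hDki2 k i)
  -- the differences `dk = wk - wt`, `Eki = Dki - Gti`
  have hdkm : ∀ k, AEStronglyMeasurable (fun x => wk k x - wt x) volume := fun k => (hwkm k).sub hwtm
  have hEkm : ∀ k i, AEStronglyMeasurable (fun x => Dki k i x - Gti i x) volume := fun k i => (hDkim k i).sub (hGtim i)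
  have hdkle : ∀ k {n : ℕ}, n ≠ 0 → ∫⁻ x in K, ‖wk k x - wt x‖ₑ ^ n ≤ eLpNorm (wk k - wt) n volume ^ n := by
    intro k n hn
    have := setLIntegral_pow_enorm_le_eLpNorm_pow (μ := volume) (wk k - wt) K hn
    simpa only [Pi.sub_apply] using this
  have hEkle : ∀ k i, ∫⁻ x in K, ‖Dki k i x - Gti i x‖ₑ ^ 2 ≤ eLpNorm (Dki k i - Gti i) 2 volume ^ 2 := by
    intro k i
    have := setLIntegral_pow_enorm_le_eLpNorm_pow (μ := volume) (Dki k i - Gti i) K two_ne_zero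
    simpa only [Pi.sub_apply, Nat.cast_ofNat] using this
  have hdktop : ∀ k {n : ℕ}, n ≠ 0 → MemLp (wk k - wt) n volume → ∫⁻ x in K, ‖wk k x - wt x‖ₑ ^ n ≠ ∞ := by
    intro k n hn hmem
    exact ne_top_of_le_ne_top (ENNReal.pow_ne_top hmem.eLpNorm_ne_top) (hdkle k hn)
  have hdk6K : ∀ k, ∫⁻ x in K, ‖wk k x - wt x‖ₑ ^ 6 ≠ ∞ := fun k =>
    hdktop k (by norm_num) (by simpa using (hwk6 k).sub hwt6)
  have hdk3K : ∀ k, ∫⁻ x in K, ‖wk k x - wt x‖ₑ ^ 3 ≠ ∞ := fun k =>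
    hdktop k (by norm_num) (by simpa using (hwk3 k).sub hwt3)
  have hdk2K : ∀ k, ∫⁻ x in K, ‖wk k x - wt x‖ₑ ^ 2 ≠ ∞ := fun k =>
    hdktop k (by norm_num) (by simpa using (hwk2 k).sub hwt2)
  have hEk2K : ∀ k i, ∫⁻ x in K, ‖Dki k i x - Gti i x‖ₑ ^ 2 ≠ ∞ := fun k i =>
    ne_top_of_le_ne_top (ENNReal.pow_ne_top ((hDki2 k i).sub (hGti2 i)).eLpNorm_ne_top) (hEkle k i)
  have hdk6le : ∀ k, ∫⁻ x in K, ‖wk k x - wt x‖ₑ ^ 6 ≤ eLpNorm (wk k - wt) 6 volume ^ 6 := fun k => by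
    simpa only [Nat.cast_ofNat] using hdkle k (n := 6) (by norm_num)
  have hdk3le : ∀ k, ∫⁻ x in K, ‖wk k x - wt x‖ₑ ^ 3 ≤ eLpNorm (wk k - wt) 3 volume ^ 3 := fun k => by
    simpa only [Nat.cast_ofNat] using hdkle k (n := 3) (by norm_num)
  have hdk2le : ∀ k, ∫⁻ x in K, ‖wk k x - wt x‖ₑ ^ 2 ≤ eLpNorm (wk k - wt) 2 volume ^ 2 := fun k => by
    simpa only [Nat.cast_ofNat] using hdkle k (n := 2) (by norm_num)
  -- ### the error sequence and its limit `0`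
  have hpiece : ∀ {a : ℕ → ℝ≥0∞} (n : ℕ) (r : ℝ), n ≠ 0 → 0 < r → Tendsto a atTop (𝓝 0) →
      Tendsto (fun k => (VT * a k ^ n) ^ r) atTop (𝓝 0) := by
    intro a n r hn hr ha
    have h1 : Tendsto (fun k => a k ^ n) atTop (𝓝 (0 ^ n)) := ((ENNReal.continuous_pow n).tendsto 0).comp ha
    have h2 : Tendsto (fun k => VT * a k ^ n) atTop (𝓝 (VT * 0 ^ n)) :=
      ENNReal.Tendsto.const_mul h1 (Or.inr hVT')
    have h3 : Tendsto (fun k => (VT * a k ^ n) ^ r) atTop (𝓝 ((VT * 0 ^ n) ^ r)) :=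
      ((ENNReal.continuous_rpow_const (y := r)).tendsto (VT * 0 ^ n)).comp h2
    simpa only [zero_pow hn, mul_zero, ENNReal.zero_rpow_of_pos hr] using h3
  have hsq2 : Tendsto (fun k => (eLpNorm (wk k - wt) 2 volume ^ 2) ^ (1 / 2 : ℝ)) atTop (𝓝 0) := by
    have h1 : Tendsto (fun k => eLpNorm (wk k - wt) 2 volume ^ 2) atTop (𝓝 (0 ^ 2)) :=
      ((ENNReal.continuous_pow 2).tendsto 0).comp hL2
    have h2 : Tendsto (fun k => (eLpNorm (wk k - wt) 2 volume ^ 2) ^ (1 / 2 : ℝ)) atTop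
        (𝓝 (((0 : ℝ≥0∞) ^ 2) ^ (1 / 2 : ℝ))) :=
      ((ENNReal.continuous_rpow_const (y := 1 / 2)).tendsto ((0 : ℝ≥0∞) ^ 2)).comp h1
    simpa only [zero_pow two_ne_zero, ENNReal.zero_rpow_of_pos (by norm_num : (0 : ℝ) < 1 / 2)] using h2
  set b : ℕ → ℝ≥0∞ := fun k =>
    ENNReal.ofReal Cψ * (AG ^ (1 / 2 : ℝ) * Av3 ^ (1 / 3 : ℝ) * (VT * eLpNorm (wk k - wt) 6 volume ^ 6) ^ (1 / 6 : ℝ)) +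
    ENNReal.ofReal CD * (Aπ ^ (2 / 3 : ℝ) * (VT * eLpNorm (wk k - wt) 3 volume ^ 3) ^ (1 / 3 : ℝ)) +
    ‖ν‖ₑ * ∑ i, AG ^ (1 / 2 : ℝ) * (ENNReal.ofReal CD * (VT * eLpNorm (wk k - wt) 2 volume ^ 2) ^ (1 / 2 : ℝ) +
      ENNReal.ofReal Cψ * (VT * eLpNorm (Dki k i - Gti i) 2 volume ^ 2) ^ (1 / 2 : ℝ)) with hb
  have hb0 : Tendsto b atTop (𝓝 0) := by
    have hT1 : Tendsto (fun k => ENNReal.ofReal Cψ * (AG ^ (1 / 2 : ℝ) * Av3 ^ (1 / 3 : ℝ) *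
        (VT * eLpNorm (wk k - wt) 6 volume ^ 6) ^ (1 / 6 : ℝ))) atTop (𝓝 0) := by
      have h1 := ENNReal.Tendsto.const_mul (a := AG ^ (1 / 2 : ℝ) * Av3 ^ (1 / 3 : ℝ))
        (hpiece 6 (1 / 6) (by norm_num) (by norm_num) hL6) (Or.inr (ENNReal.mul_ne_top hAGtop hAv3top))
      have h2 := ENNReal.Tendsto.const_mul (a := ENNReal.ofReal Cψ) h1 (Or.inr ENNReal.ofReal_ne_top)
      simpa only [mul_zero] using h2
    have hT2 : Tendsto (fun k => ENNReal.ofReal CD * (Aπ ^ (2 / 3 : ℝ) *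
        (VT * eLpNorm (wk k - wt) 3 volume ^ 3) ^ (1 / 3 : ℝ))) atTop (𝓝 0) := by
      have h1 := ENNReal.Tendsto.const_mul (a := Aπ ^ (2 / 3 : ℝ))
        (hpiece 3 (1 / 3) (by norm_num) (by norm_num) hL3) (Or.inr hAπtop)
      have h2 := ENNReal.Tendsto.const_mul (a := ENNReal.ofReal CD) h1 (Or.inr ENNReal.ofReal_ne_top)
      simpa only [mul_zero] using h2
    have hT3 : Tendsto (fun k => ‖ν‖ₑ * ∑ i, AG ^ (1 / 2 : ℝ) *
        (ENNReal.ofReal CD * (VT * eLpNorm (wk k - wt) 2 volume ^ 2) ^ (1 / 2 : ℝ) +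
          ENNReal.ofReal Cψ * (VT * eLpNorm (Dki k i - Gti i) 2 volume ^ 2) ^ (1 / 2 : ℝ))) atTop (𝓝 0) := by
      have hi : ∀ i, Tendsto (fun k => AG ^ (1 / 2 : ℝ) *
          (ENNReal.ofReal CD * (VT * eLpNorm (wk k - wt) 2 volume ^ 2) ^ (1 / 2 : ℝ) +
            ENNReal.ofReal Cψ * (VT * eLpNorm (Dki k i - Gti i) 2 volume ^ 2) ^ (1 / 2 : ℝ))) atTop (𝓝 0) := by
        intro i
        have h1 := ENNReal.Tendsto.const_mul (a := ENNReal.ofReal CD)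
          (hpiece 2 (1 / 2) (by norm_num) (by norm_num) hL2) (Or.inr ENNReal.ofReal_ne_top)
        have h2 := ENNReal.Tendsto.const_mul (a := ENNReal.ofReal Cψ)
          (hpiece 2 (1 / 2) (by norm_num) (by norm_num) (hDL2 i)) (Or.inr ENNReal.ofReal_ne_top)
        have h3 := ENNReal.Tendsto.const_mul (a := AG ^ (1 / 2 : ℝ)) (h1.add h2) (Or.inr hAGtop)
        simpa only [mul_zero, add_zero] using h3
      have hs := tendsto_finsetSum (Finset.univ : Finset (Fin (Module.finrank ℝ (EuclideanSpace ℝ (Fin 3)))))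
        fun i _ => hi i
      have h4 := ENNReal.Tendsto.const_mul (a := ‖ν‖ₑ) hs (Or.inr enorm_ne_top)
      simpa only [Finset.sum_const_zero, mul_zero] using h4
    rw [hb]
    have := (hT1.add hT2).add hT3
    simpa only [add_zero] using this
  -- ### vanishing of the three integrands off `K`
  have hz1 : ∀ (u : EuclideanSpace ℝ (Fin 3) → EuclideanSpace ℝ (Fin 3)) (z : ℝ × EuclideanSpace ℝ (Fin 3)),
      z.2 ∉ K → ⟪G z.1 z.2 (v z.1 z.2), ψ z.2 • u z.2⟫ = 0 := fun u z hz => by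
    rw [hψ0 z.2 (fun h' => hz (hBK (hψK h'))), zero_smul, inner_zero_right]
  have hz2 : ∀ (u : EuclideanSpace ℝ (Fin 3) → EuclideanSpace ℝ (Fin 3)) (z : ℝ × EuclideanSpace ℝ (Fin 3)),
      z.2 ∉ K → π z.1 z.2 * fderiv ℝ ψ z.2 (u z.2) = 0 := fun u z hz => by
    rw [hDψ0 z.2 (fun h' => hz (hBK (hψK h'))), _root_.zero_apply, mul_zero]
  have hz3 : ∀ (u : EuclideanSpace ℝ (Fin 3) → EuclideanSpace ℝ (Fin 3))
      (Dv : Fin (Module.finrank ℝ (EuclideanSpace ℝ (Fin 3))) → EuclideanSpace ℝ (Fin 3) → EuclideanSpace ℝ (Fin 3))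
      (z : ℝ × EuclideanSpace ℝ (Fin 3)), z.2 ∉ K →
      ∑ i, ⟪G z.1 z.2 (e i), fderiv ℝ ψ z.2 (e i) • u z.2 + ψ z.2 • Dv i z.2⟫ = 0 := fun u Dv z hz => by
    have hx : z.2 ∉ tsupport ψ := fun h' => hz (hBK (hψK h'))
    simp [hψ0 z.2 hx, hDψ0 z.2 hx]
  -- ### good slices and the datum
  have hmeas : AEStronglyMeasurable (uncurry v)
      ((volume : Measure (ℝ × EuclideanSpace ℝ (Fin 3))).restrict (Ioo 0 T ×ˢ univ)) := h.aestronglyMeasurable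
  have hsq : ∀ K' : Set (EuclideanSpace ℝ (Fin 3)), IsCompact K' →
      ∫⁻ z in Ioo 0 T ×ˢ K', ‖uncurry v z‖ₑ ^ 2 < ∞ := fun K' hK' => h.sqIntegrable K' hK'
  have hgood := ae_slice_aestronglyMeasurable_and_lintegral_ball_lt_top hmeas hsq
  have hgoodK : ∀ᵐ t ∂((volume : Measure ℝ).restrict (Ioo 0 T)),
      AEStronglyMeasurable (v t) (volume : Measure (EuclideanSpace ℝ (Fin 3))) ∧ ∫⁻ x in K, ‖v t x‖ₑ ^ 2 < ∞ := by
    filter_upwards [hgood] with t ht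
    exact ⟨ht.1, (lintegral_mono_set (closedBall_subset_closedBall (Nat.le_ceil R))).trans_lt (ht.2 ⌈R⌉₊)⟩
  have hv₀K : ∫⁻ x in K, ‖v₀ x‖ₑ ^ 2 < ∞ := lintegral_datum_sq_lt_top hT hgoodK hm₀ (h.initial K hK)
  have hm₀K : AEStronglyMeasurable v₀ (volume.restrict K) := hm₀.restrict
  -- ### convergence of the space pairings
  have hAlim : ∀ {q : EuclideanSpace ℝ (Fin 3) → EuclideanSpace ℝ (Fin 3)},
      AEStronglyMeasurable q (volume.restrict K) → ∫⁻ x in K, ‖q x‖ₑ ^ 2 ≠ ∞ →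
      Tendsto (fun k => ∫ x, ⟪q x, ψ x • wk k x⟫) atTop (𝓝 (∫ x, ⟪q x, ψ x • wt x⟫)) := by
    intro q hqm hq2
    rw [tendsto_iff_edist_tendsto_0]
    have hbd : ∀ k, edist (∫ x, ⟪q x, ψ x • wk k x⟫) (∫ x, ⟪q x, ψ x • wt x⟫) ≤
        ENNReal.ofReal Cψ * ((∫⁻ x in K, ‖q x‖ₑ ^ 2) ^ (1 / 2 : ℝ) *
          (eLpNorm (wk k - wt) 2 volume ^ 2) ^ (1 / 2 : ℝ)) := by
      intro k
      rw [edist_eq_enorm_sub, ← integral_sub (hpair hqm hq2 (hwkm k) (hwk2K k)).1 (hpair hqm hq2 hwtm hwt2K).1]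
      have : (fun x => ⟪q x, ψ x • wk k x⟫ - ⟪q x, ψ x • wt x⟫) = fun x => ⟪q x, ψ x • (wk k x - wt x)⟫ := by
        funext x; rw [smul_sub, inner_sub_right]
      rw [this]
      refine (hpair hqm hq2 (hdkm k) (hdk2K k)).2.trans ?_
      gcongr
      exact hdk2le k
    refine tendsto_of_tendsto_of_tendsto_of_le_of_le' tendsto_const_nhds ?_
      (Eventually.of_forall fun _ => zero_le) (Eventually.of_forall hbd)
    have h3 := ENNReal.Tendsto.const_mul (a := (∫⁻ x in K, ‖q x‖ₑ ^ 2) ^ (1 / 2 : ℝ)) hsq2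
      (Or.inr (ENNReal.rpow_ne_top_of_nonneg (by norm_num) hq2))
    have h4 := ENNReal.Tendsto.const_mul (a := ENNReal.ofReal Cψ) h3 (Or.inr ENNReal.ofReal_ne_top)
    simpa only [mul_zero] using h4
  -- ### the main step, on a good slice
  filter_upwards [hidk, hgoodK, ae_restrict_mem measurableSet_Ioo] with t hid hgt htI
  have hvtm : AEStronglyMeasurable (v t) (volume.restrict K) := hgt.1.restrict
  have hvt2 : ∫⁻ x in K, ‖v t x‖ₑ ^ 2 ≠ ∞ := hgt.2.ne
  set μ : Measure (ℝ × EuclideanSpace ℝ (Fin 3)) :=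
    ((volume : Measure ℝ).restrict (Ioc 0 t)).prod (volume : Measure (EuclideanSpace ℝ (Fin 3))) with hμ
  -- integrability of the bulk integrands on `(0,t] × ℝ³`
  have hI1t := hvan_of (hz1 wt) (hInt1 hwtm hwt6K).1 htI.2
  have hI2t := hvan_of (hz2 wt) (hInt2 hwtm hwt3K).1 htI.2
  have hI3t := hvan_of (hz3 wt Gti) (hInt3 hwtm hGtim hwt2K hGti2K).1 htI.2
  have hI1k := fun k => hvan_of (hz1 (wk k)) (hInt1 (hwkm k) (hwk6K k)).1 htI.2
  have hI2k := fun k => hvan_of (hz2 (wk k)) (hInt2 (hwkm k) (hwk3K k)).1 htI.2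
  have hI3k := fun k => hvan_of (hz3 (wk k) (Dki k)) (hInt3 (hwkm k) (hDkim k) (hwk2K k) (hDki2K k)).1 htI.2
  -- Fubini for the limit field and for the approximations
  have ePhit : ∫ s in Ioc 0 t, (((-∫ x, ⟪G s x (v s x), ψ x • wt x⟫) + ∫ x, π s x * fderiv ℝ ψ x (wt x)) -
      ν * ∫ x, ∑ i, ⟪G s x (e i), fderiv ℝ ψ x (e i) • wt x + ψ x • Gti i x⟫) =
      ((-∫ z, ⟪G z.1 z.2 (v z.1 z.2), ψ z.2 • wt z.2⟫ ∂μ) + ∫ z, π z.1 z.2 * fderiv ℝ ψ z.2 (wt z.2) ∂μ) -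
        ν * ∫ z, ∑ i, ⟪G z.1 z.2 (e i), fderiv ℝ ψ z.2 (e i) • wt z.2 + ψ z.2 • Gti i z.2⟫ ∂μ :=
    hPhi hI1t hI2t hI3t
  have ePhik : ∀ k, ∫ s in Ioc 0 t, (((-∫ x, ⟪G s x (v s x), ψ x • wk k x⟫) +
      ∫ x, π s x * fderiv ℝ ψ x (wk k x)) -
      ν * ∫ x, ∑ i, ⟪G s x (e i), fderiv ℝ ψ x (e i) • wk k x + ψ x • Dki k i x⟫) =
      ((-∫ z, ⟪G z.1 z.2 (v z.1 z.2), ψ z.2 • wk k z.2⟫ ∂μ) + ∫ z, π z.1 z.2 * fderiv ℝ ψ z.2 (wk k z.2) ∂μ) -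
        ν * ∫ z, ∑ i, ⟪G z.1 z.2 (e i), fderiv ℝ ψ z.2 (e i) • wk k z.2 + ψ z.2 • Dki k i z.2⟫ ∂μ := fun k =>
    hPhi (hI1k k) (hI2k k) (hI3k k)
  -- the identities for the smooth approximations
  have hEq : ∀ᶠ k in atTop, ∫ x, ⟪v t x, ψ x • wk k x⟫ = (∫ x, ⟪v₀ x, ψ x • wk k x⟫) +
      (((-∫ z, ⟪G z.1 z.2 (v z.1 z.2), ψ z.2 • wk k z.2⟫ ∂μ) + ∫ z, π z.1 z.2 * fderiv ℝ ψ z.2 (wk k z.2) ∂μ) -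
        ν * ∫ z, ∑ i, ⟪G z.1 z.2 (e i), fderiv ℝ ψ z.2 (e i) • wk k z.2 + ψ z.2 • Dki k i z.2⟫ ∂μ) := by
    filter_upwards [hN] with k hk
    have hid' := hid k
    rw [← he] at hid'
    simp only [hdivk k hk, hderk k hk] at hid'
    rw [hid']
    congr 1
    exact ePhik k
  -- the bulk functional converges
  have hΦbd : ∀ k, edist ((((-∫ z, ⟪G z.1 z.2 (v z.1 z.2), ψ z.2 • wk k z.2⟫ ∂μ) +
      ∫ z, π z.1 z.2 * fderiv ℝ ψ z.2 (wk k z.2) ∂μ) -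
        ν * ∫ z, ∑ i, ⟪G z.1 z.2 (e i), fderiv ℝ ψ z.2 (e i) • wk k z.2 + ψ z.2 • Dki k i z.2⟫ ∂μ))
      ((((-∫ z, ⟪G z.1 z.2 (v z.1 z.2), ψ z.2 • wt z.2⟫ ∂μ) + ∫ z, π z.1 z.2 * fderiv ℝ ψ z.2 (wt z.2) ∂μ) -
        ν * ∫ z, ∑ i, ⟪G z.1 z.2 (e i), fderiv ℝ ψ z.2 (e i) • wt z.2 + ψ z.2 • Gti i z.2⟫ ∂μ)) ≤ b k := by
    intro k
    rw [edist_eq_enorm_sub]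
    have hd1 : (∫ z, ⟪G z.1 z.2 (v z.1 z.2), ψ z.2 • wk k z.2⟫ ∂μ) - ∫ z, ⟪G z.1 z.2 (v z.1 z.2), ψ z.2 • wt z.2⟫ ∂μ =
        ∫ z, ⟪G z.1 z.2 (v z.1 z.2), ψ z.2 • (wk k z.2 - wt z.2)⟫ ∂μ := by
      rw [← integral_sub (hI1k k) hI1t]
      refine integral_congr_ae (Eventually.of_forall fun z => ?_)
      simp only [smul_sub, inner_sub_right]
    have hd2 : (∫ z, π z.1 z.2 * fderiv ℝ ψ z.2 (wk k z.2) ∂μ) - ∫ z, π z.1 z.2 * fderiv ℝ ψ z.2 (wt z.2) ∂μ =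
        ∫ z, π z.1 z.2 * fderiv ℝ ψ z.2 (wk k z.2 - wt z.2) ∂μ := by
      rw [← integral_sub (hI2k k) hI2t]
      refine integral_congr_ae (Eventually.of_forall fun z => ?_)
      simp only [map_sub, mul_sub]
    have hd3 : (∫ z, ∑ i, ⟪G z.1 z.2 (e i), fderiv ℝ ψ z.2 (e i) • wk k z.2 + ψ z.2 • Dki k i z.2⟫ ∂μ) -
        ∫ z, ∑ i, ⟪G z.1 z.2 (e i), fderiv ℝ ψ z.2 (e i) • wt z.2 + ψ z.2 • Gti i z.2⟫ ∂μ =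
        ∫ z, ∑ i, ⟪G z.1 z.2 (e i), fderiv ℝ ψ z.2 (e i) • (wk k z.2 - wt z.2) +
          ψ z.2 • (Dki k i z.2 - Gti i z.2)⟫ ∂μ := by
      rw [← integral_sub (hI3k k) hI3t]
      refine integral_congr_ae (Eventually.of_forall fun z => ?_)
      simp only [← Finset.sum_sub_distrib, ← inner_sub_right]
      refine Finset.sum_congr rfl fun i _ => ?_
      congr 1
      rw [smul_sub, smul_sub]
      abel
    have hB1 : ‖∫ z, ⟪G z.1 z.2 (v z.1 z.2), ψ z.2 • (wk k z.2 - wt z.2)⟫ ∂μ‖ₑ ≤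
        ENNReal.ofReal Cψ * (AG ^ (1 / 2 : ℝ) * Av3 ^ (1 / 3 : ℝ) *
          (VT * eLpNorm (wk k - wt) 6 volume ^ 6) ^ (1 / 6 : ℝ)) :=
      calc _ ≤ ∫⁻ z, ‖⟪G z.1 z.2 (v z.1 z.2), ψ z.2 • (wk k z.2 - wt z.2)⟫‖ₑ ∂μ :=
            enorm_integral_le_lintegral_enorm _
        _ ≤ ∫⁻ z in Ioo (0 : ℝ) T ×ˢ K, ‖⟪G z.1 z.2 (v z.1 z.2), ψ z.2 • (wk k z.2 - wt z.2)⟫‖ₑ :=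
            hlin_of (hz1 fun x => wk k x - wt x) htI.2
        _ ≤ ENNReal.ofReal Cψ * (AG ^ (1 / 2 : ℝ) * Av3 ^ (1 / 3 : ℝ) *
              (VT * ∫⁻ x in K, ‖wk k x - wt x‖ₑ ^ 6) ^ (1 / 6 : ℝ)) := (hInt1 (hdkm k) (hdk6K k)).2
        _ ≤ _ := by gcongr; exact hdk6le k
    have hB2 : ‖∫ z, π z.1 z.2 * fderiv ℝ ψ z.2 (wk k z.2 - wt z.2) ∂μ‖ₑ ≤
        ENNReal.ofReal CD * (Aπ ^ (2 / 3 : ℝ) * (VT * eLpNorm (wk k - wt) 3 volume ^ 3) ^ (1 / 3 : ℝ)) :=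
      calc _ ≤ ∫⁻ z, ‖π z.1 z.2 * fderiv ℝ ψ z.2 (wk k z.2 - wt z.2)‖ₑ ∂μ := enorm_integral_le_lintegral_enorm _
        _ ≤ ∫⁻ z in Ioo (0 : ℝ) T ×ˢ K, ‖π z.1 z.2 * fderiv ℝ ψ z.2 (wk k z.2 - wt z.2)‖ₑ :=
            hlin_of (hz2 fun x => wk k x - wt x) htI.2
        _ ≤ ENNReal.ofReal CD * (Aπ ^ (2 / 3 : ℝ) * (VT * ∫⁻ x in K, ‖wk k x - wt x‖ₑ ^ 3) ^ (1 / 3 : ℝ)) :=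
            (hInt2 (hdkm k) (hdk3K k)).2
        _ ≤ _ := by gcongr; exact hdk3le k
    have hB3 : ‖∫ z, ∑ i, ⟪G z.1 z.2 (e i), fderiv ℝ ψ z.2 (e i) • (wk k z.2 - wt z.2) +
          ψ z.2 • (Dki k i z.2 - Gti i z.2)⟫ ∂μ‖ₑ ≤
        ∑ i, AG ^ (1 / 2 : ℝ) * (ENNReal.ofReal CD * (VT * eLpNorm (wk k - wt) 2 volume ^ 2) ^ (1 / 2 : ℝ) +
          ENNReal.ofReal Cψ * (VT * eLpNorm (Dki k i - Gti i) 2 volume ^ 2) ^ (1 / 2 : ℝ)) :=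
      calc _ ≤ ∫⁻ z, ‖∑ i, ⟪G z.1 z.2 (e i), fderiv ℝ ψ z.2 (e i) • (wk k z.2 - wt z.2) +
              ψ z.2 • (Dki k i z.2 - Gti i z.2)⟫‖ₑ ∂μ := enorm_integral_le_lintegral_enorm _
        _ ≤ ∫⁻ z in Ioo (0 : ℝ) T ×ˢ K, ‖∑ i, ⟪G z.1 z.2 (e i), fderiv ℝ ψ z.2 (e i) • (wk k z.2 - wt z.2) +
              ψ z.2 • (Dki k i z.2 - Gti i z.2)⟫‖ₑ :=
            hlin_of (hz3 (fun x => wk k x - wt x) fun i x => Dki k i x - Gti i x) htI.2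
        _ ≤ ∑ i, AG ^ (1 / 2 : ℝ) * (ENNReal.ofReal CD * (VT * ∫⁻ x in K, ‖wk k x - wt x‖ₑ ^ 2) ^ (1 / 2 : ℝ) +
              ENNReal.ofReal Cψ * (VT * ∫⁻ x in K, ‖Dki k i x - Gti i x‖ₑ ^ 2) ^ (1 / 2 : ℝ)) :=
            (hInt3 (hdkm k) (hEkm k) (hdk2K k) (hEk2K k)).2
        _ ≤ _ := by
            refine Finset.sum_le_sum fun i _ => ?_
            gcongr
            · exact hdk2le k
            · exact hEkle k i
    have halg : ((((-∫ z, ⟪G z.1 z.2 (v z.1 z.2), ψ z.2 • wk k z.2⟫ ∂μ) +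
        ∫ z, π z.1 z.2 * fderiv ℝ ψ z.2 (wk k z.2) ∂μ) -
          ν * ∫ z, ∑ i, ⟪G z.1 z.2 (e i), fderiv ℝ ψ z.2 (e i) • wk k z.2 + ψ z.2 • Dki k i z.2⟫ ∂μ)) -
        ((((-∫ z, ⟪G z.1 z.2 (v z.1 z.2), ψ z.2 • wt z.2⟫ ∂μ) + ∫ z, π z.1 z.2 * fderiv ℝ ψ z.2 (wt z.2) ∂μ) -
          ν * ∫ z, ∑ i, ⟪G z.1 z.2 (e i), fderiv ℝ ψ z.2 (e i) • wt z.2 + ψ z.2 • Gti i z.2⟫ ∂μ)) =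
        ((-((∫ z, ⟪G z.1 z.2 (v z.1 z.2), ψ z.2 • wk k z.2⟫ ∂μ) -
            ∫ z, ⟪G z.1 z.2 (v z.1 z.2), ψ z.2 • wt z.2⟫ ∂μ)) +
          ((∫ z, π z.1 z.2 * fderiv ℝ ψ z.2 (wk k z.2) ∂μ) - ∫ z, π z.1 z.2 * fderiv ℝ ψ z.2 (wt z.2) ∂μ)) -
        ν * ((∫ z, ∑ i, ⟪G z.1 z.2 (e i), fderiv ℝ ψ z.2 (e i) • wk k z.2 + ψ z.2 • Dki k i z.2⟫ ∂μ) -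
          ∫ z, ∑ i, ⟪G z.1 z.2 (e i), fderiv ℝ ψ z.2 (e i) • wt z.2 + ψ z.2 • Gti i z.2⟫ ∂μ) := by ring
    rw [halg, hd1, hd2, hd3]
    calc _ ≤ ‖(-∫ z, ⟪G z.1 z.2 (v z.1 z.2), ψ z.2 • (wk k z.2 - wt z.2)⟫ ∂μ) +
          ∫ z, π z.1 z.2 * fderiv ℝ ψ z.2 (wk k z.2 - wt z.2) ∂μ‖ₑ +
          ‖ν * ∫ z, ∑ i, ⟪G z.1 z.2 (e i), fderiv ℝ ψ z.2 (e i) • (wk k z.2 - wt z.2) +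
            ψ z.2 • (Dki k i z.2 - Gti i z.2)⟫ ∂μ‖ₑ := enorm_sub_le
      _ ≤ (‖∫ z, ⟪G z.1 z.2 (v z.1 z.2), ψ z.2 • (wk k z.2 - wt z.2)⟫ ∂μ‖ₑ +
            ‖∫ z, π z.1 z.2 * fderiv ℝ ψ z.2 (wk k z.2 - wt z.2) ∂μ‖ₑ) +
          ‖ν‖ₑ * ‖∫ z, ∑ i, ⟪G z.1 z.2 (e i), fderiv ℝ ψ z.2 (e i) • (wk k z.2 - wt z.2) +
            ψ z.2 • (Dki k i z.2 - Gti i z.2)⟫ ∂μ‖ₑ := by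
          rw [enorm_mul]
          refine add_le_add ((enorm_add_le _ _).trans_eq ?_) le_rfl
          rw [enorm_neg]
      _ ≤ b k := add_le_add (add_le_add hB1 hB2) (mul_le_mul' le_rfl hB3)
  have hΦlim : Tendsto (fun k => (((-∫ z, ⟪G z.1 z.2 (v z.1 z.2), ψ z.2 • wk k z.2⟫ ∂μ) +
      ∫ z, π z.1 z.2 * fderiv ℝ ψ z.2 (wk k z.2) ∂μ) -
        ν * ∫ z, ∑ i, ⟪G z.1 z.2 (e i), fderiv ℝ ψ z.2 (e i) • wk k z.2 + ψ z.2 • Dki k i z.2⟫ ∂μ)) atTop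
      (𝓝 ((((-∫ z, ⟪G z.1 z.2 (v z.1 z.2), ψ z.2 • wt z.2⟫ ∂μ) + ∫ z, π z.1 z.2 * fderiv ℝ ψ z.2 (wt z.2) ∂μ) -
        ν * ∫ z, ∑ i, ⟪G z.1 z.2 (e i), fderiv ℝ ψ z.2 (e i) • wt z.2 + ψ z.2 • Gti i z.2⟫ ∂μ))) := by
    rw [tendsto_iff_edist_tendsto_0]
    exact tendsto_of_tendsto_of_tendsto_of_le_of_le' tendsto_const_nhds hb0
      (Eventually.of_forall fun _ => zero_le) (Eventually.of_forall hΦbd)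
  -- ### conclusion
  have hlimL := hAlim hvtm hvt2
  have hlimR := (hAlim hm₀K hv₀K.ne).add hΦlim
  have key := tendsto_nhds_unique hlimL (hlimR.congr' (hEq.mono fun k hk => hk.symm))
  simp only [hψw, hDψw', hDψw, hψG]
  rw [ePhit]
  exact key

end IsLocalLeraySolutionOn

end Literature.Analysis.FluidPDE
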